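import Literature.MathematicalPhysics.QuantumFieldTheory.Balaban1983to89.B9Thm311ClassCompactnessZdPer
import Literature.MathematicalPhysics.QuantumFieldTheory.Balaban1983to89.B9Thm33GlobalBlockWitnessCubeZd
import Literature.MathematicalPhysics.QuantumFieldTheory.Balaban1983to89.B9Thm311FlatPropagatorBoundZdPer
import Literature.MathematicalPhysics.QuantumFieldTheory.Balaban1983to89.B9B8KnitHolderZeroOfGlob

/-!
# `Balaban1983to89.B9Thm33GlobalBlockWitnessZdPer` — [Balaban1985BackgroundPropagators] Thm 3.3 p. 399 ∕ (3.47) p. 398 and Thm 3.11 p. 416 ON THE TORUS `T_P`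
# READ ON `ℤᵈ`, PER MEMBER, FOR THE GENUINE RECORD: ONE coercivity constant `c·⟨A, A⟩_per ≤ ⟨A, Δ_a(U₀)A⟩_per` on the COMPACT small-plaquette class of periodic
# unitary backgrounds, the pointwise bound `‖(G_𝔤^per(U₀)J)(b)‖ ≤ N·|J|₍₋₃₎` ([4] (2.22)), the three global (3.47) entries at `γ = −3` — `GlobAtIPer` INHABITED
# at lit-balaban's torus member `torusIdx` — and, with `InvAtHIPer` (`B9Thm311ClassCompactnessZdPer`) and the `β = 0` Hölder line of lit-balaban t2s
# (`B9B8KnitHolderZeroOfGlob`), pub-ymgap's periodic socket `SockB9P3Per` ([B8] (1.59) on the torus) for the genuine record `opsAllZdPer` at `torusIdx` with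
# NO binder of Bałaban's left: the torus twin of this seat's g20 `B9Thm33GlobalBlockWitnessCubeZd`

statement-level skeleton of published theorems with citation tags; proofs where landed; nothing here is a claim about the
Yang–Mills mass gap

`[Balaban1985BackgroundPropagators]` ("B9", CMP **99** (1985) 389–434) Thm 3.3 p. 399 with (3.47) p. 398 *«|G(U)J|₍γ₊₂₎, |∇_U G(U)J|₍γ₊₁₎, |Δ_U G(U)J|₍γ₎ ≤ B₀|J|₍γ₎»*;
Thm 3.11 p. 416 *«the operators Δ′_a, G′, …, Δ_a, G are positive definite»*; (3.26)–(3.27) p. 395.  `[Balaban1984PropagatorsII]` ("[4]", CMP **96**) (2.22) p. 226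
*«the operator Δ_a is bounded from below by a positive constant»*.  `[Balaban1985RegularSpaces]` (1.58)–(1.59) p. 86, Prop. 3 p. 87, (1.7) p. 77, p. 77
*«Ω_j = T_η»*.  PDF held: `paper:balaban1985-cmp99-background-propagators` pp. 395, 398–399, 416.

CITATION HEADER (lean-in-tree rule).  Cell `pub-ymgap` (YM Track A), DAG node N06 = [B9], seat `pub-ymgap-dag-n06-b` (g24), the (β′-PERIODIC) road
(director-ym №217 (1)); HANDOFF-dag-n06-b §2q WHAT REMAINS (1), second half.  WHY: the periodic socket for the genuine torus record
(`B9SupplySockB9P3ZdPer.sockB9P3Per_opsAllZdPer_of_binders`) displays THREE analytic binders — `InvAtHIPer` (Thm 3.11: THEOREM per member, FILE 2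
`B9Thm311ClassCompactnessZdPer.invAtHIPer_opsAllZdPer_torusIdx`), `GlobAtIPer` (Thm 3.3's (3.47)@−3) and `HolderAtIPer` ((3.45)).  THIS FILE proves `GlobAtIPer` per
member by COMPACTNESS (uniform coercivity on the compact small-plaquette class + finite-dimensional norm comparison on the period cell, exactly as g20 did on the
cube with dag-n06-w4's `exists_coercive_closedBall_one_cube`) and assembles the socket; the `β = 0` Hölder line is lit-balaban t2s's `holderAtIPer_zero_of_globAtIPer`.
Tools BY NAME: dag-n06-w4's abstract `B9Eq335UnitaryClassCompactZd.exists_coercive_of_isCompact`, `B9Thm31CoercivePrimeCompactZd.{isCompact_unitary_plaqClosed,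
reg17Univ_of_forall_plaqF_le}`, `B9Thm311PosDefOpenRegimeZd.wcx_avgIter_lt_one_of_reg17UnivP` (the disc condition at CLASS points), FILE 1's `…_of_base` letters
continuity; dag-n06-w3's `bondPairPer_le_young` ∕ `deltaAOf_gopZdHPer_of_mem`; g20's `exists_norm_sq_le_re_trace`; lit-balaban t2s's `norm_le_sum_box_of_isPeriodic`.

WHAT IS PROVED (kernel, 0 sorry; theorems only — no `def`, no `instance`, no `notation`).
* §1 ★★ `exists_coercive_per_of_isCompact` (THE PERIODIC COERCIVITY ENGINE: a record whose `Δ_a(U₀)` is ℝ-linear on `𝒰 ⊇ K`, with letters continuous within the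
  COMPACT `K` at every point of `K` on `E_𝔤^per(P)` and `⟨A, Δ_a(U₀)A⟩_per > 0` on `E_𝔤^per(P) ∖ 0` for `U₀ ∈ K`, has ONE `c > 0` with `c·⟨A,A⟩_per ≤ ⟨A, Δ_a(U₀)A⟩_per`
  for all `U₀ ∈ K`, `A ∈ E_𝔤^per(P)` — the torus twin of `exists_coercive_on_of_isCompact`).
* §2 (positivity near the flat set at `torusIdx`) ★★★ `bondPairPer_pos_eventually_torusIdx_canonical_of_flat` (the vector form, FILE 1 §4 at `torusIdx`), ★★
  `scalarPos_eventually_of_flat` (the scalar form `⟨f, Δ′_a(U₀)f⟩ > 0`, weights `a ≡ 1`, class `torusLam`, in the FULL neighbourhood filter).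
* §3 ★★★★ `exists_coercive_plaqNear_torusIdx` (∃ `α, c > 0`: EVERY unitary `P`-periodic `U₀` ALL of whose plaquette variables are `α`-close to `1` has
  `RegularAtHPer` AND `c·⟨A, A⟩_per ≤ ⟨A, Δ_a(U₀)A⟩_per` on `E_𝔤^per(P)` for the genuine torus record — [4] p. 226 «bounded from below by a positive constant»,
  per member, for the whole closed small-plaquette class at once; `0 < d`, `2 ≤ L`, `Lᵐ ∣ P`).
* §4 ★★★ `exists_apply_bound_gopZdHPer_plaqNear_torusIdx` ([4] (2.22) + the fibre comparison: `‖(G_𝔤^per(U₀)J)(b)‖ ≤ N·|J|₍₋₃₎` for every periodic Hermitian `J`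
  and every bond, same class), with `eta_cube_mul_norm_le_bondNorm_per` (a periodic field's `|·|₍₋₃₎`-family over ALL bonds is bounded; `η³‖J(b)‖ ≤ |J|₍₋₃₎`).
* §5 ★★★★ `globAtIPer_opsAllZdPer_torusIdx` (`∃ aT B₀ > 0, GlobAtIPer P L (opsAllZdPer τ L P torusLamb ops₀) aT B₀ M (torusIdx t) m` — THE GLOBAL (3.47) BLOCK OF
  THM 3.3 AT `γ = −3` FOR THE GENUINE `G_𝔤^per`, PER MEMBER; `B₀ = S·N + S²·2η⁻¹N + S³·4dη⁻²N + 1`, `S = Lᵐη`), `gop_isPeriodic_opsAllZdPer'` (the record's `Gop`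
  is periodic on periodic Hermitian data), ★★★ `holderAtIPer_zero_opsAllZdPer_torusIdx` (the `β = 0` Hölder binder, via lit-balaban t2s).
* §6 `levelSepPP0_torusIdx'` (EDITION P₀'s class law at the all-torus class, `s = 0`), ★★★★★ `sockB9P3Per_genuine_torusIdx` (THE PERIODIC SOCKET OF [B8] (1.59) FOR
  THE GENUINE RECORD AT `torusIdx`, `β = 0`, WITH NO BINDER OF BAŁABAN'S LEFT: `∃ aI aT B₀ > 0, SockB9P3Per P L (max 1 (2B₀·max 1 q)) (2·max 0 (2B₀)·max 1 q)
  (min (1∕16) (min aI (min aT (1∕(2B₀·14(d−1)·M+1))))) 0 len t.η m univ torusLam torusLamb`, `q = qQ d L C_τ β_τ 0`; `2 ≤ d`, `2 ≤ L`, `Lᵐ ∣ P`, `1 ≤ M`, any `len`).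
* §7 ★★ `holderAtIPer_of_globAtIPer_of_len` (ANY exponent `0 ≤ β`, lengths `≥ 1` on admissible pairs: `GlobAtIPer … aT B₀ ⟹ HolderAtIPer … aT (2B₀(Lᵐ)^β) β len` —
  the quotient (3.40) is `≤ (‖F x′‖ + ‖F x‖)·η^{−β}`, the weight `(Lʲη)^{2+β} ≤ (Lʲη)²(Lᵐη)^β`; generic record with periodic `Gop`, `Ω_j = ℤᵈ`), ★★★★★
  `sockB9P3Per_genuine_torusIdx_beta` (the socket at ANY `0 ≤ β`, `B₀β′ = 2·max 0 (2B₀(Lᵐ)^β)·max 1 q`).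

HONEST SCOPE.  (i) QUALITATIVE: `α, c, N, aT, B₀, aI` exist by compactness and finite dimension and are member-, `P`-, `τ`-dependent; print's Theorem 3.3 ∕ 3.11
constants `δ₀(d,L), B₀, M₀, α₀′` are UNIFORM in the volume (Sects. B–E; the coercivity road of dag-n06-w3∕w4) — NOT proved here; no decay ((3.42)) is claimed.
(ii) The Hölder line is CRUDE: at `β = 0` a sup bound (lit-balaban t2s), at `0 ≤ β` the same sup bound with the factor `(Lᵐ)^β` from `(Lʲη)^β∕η^β` (§7) —
print's (3.43)∕(3.45) Hölder members carry genuinely `β`-Hölder decay kernels, NOT proved here.  (iii) Count-neutral; N05 ∕ N06 NOT discharged; K1⁹ `stmt-QuantumFields-27364` NOT closed; one finite `𝕋⁴` programme at fixed `ε`,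
Bałaban as printed; R4 closes only the conditional finite-`𝕋⁴` rung `BalabanLadder.UV` — nothing continuum ∕ ℝ⁴ ∕ OS ∕ mass gap ∕ Clay.  Unit `pub-ymgap-dag-n06-b`
(g24), 2026-08-28.
-/

noncomputable section

namespace Literature.MathematicalPhysics.QuantumFieldTheory.Balaban1983to89.B9Thm33GlobalBlockWitnessZdPer

open Filter Topology
open B7Prop1Explicit B7Eq78Linearization
open B7Prop2Explicit (unitaryUnits unitaryUnits_le_U1 avgIter)
open B7Prop1Local (InBox loK bondHiK)
open B8Ineq132 (covDerivFwd plaqF InAk BondTouches)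
open B8Eq140Level (SideTouches)
open B8ScaledSupNorm (bondNorm msup weight Bdd)
open B8Eq138LandauZd (covLap)
open B8Eq119TwistedAxial (bgT)
open B8LeafModelZd (ZdIdx)
open T4TermwiseTorus (IsPeriodic box tcls tlift tlift_mem_box)
open B9SupplySockB9P3ZdLetters (OpsZd deltaAOf)
open B9SupplySockB9P3ZdLettersOmega (norm_covDerivFwd_le norm_covLap_le)
open B9SupplySockB9P3ZdGammaInAkDpZd (withDpZd)
open B9Eq316AveragingTransposeZd (tauForm tauForm_apply Reg17 alphaQ alphaQ_pos qQ betaTau)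
open B9Eq316AveragingTransposeZdPrinted (withQQP)
open B9Eq327GreenZd (LinearOnDomAt)
open B9Eq327GreenZdHermPer (domSubHPer mem_domSubHPer_iff finiteDimensional_domSubHPer RegularAtHPer bondPairPer mem_domSub_univ gopZdHPer
  gopZdHPer_mem_domSubHPer withGopZdHPer_Gop deltaAOf_withGopZdHPer isPeriodic_apply_dir InvAtHIPer)
open B9Eq321LandauProjectionZdPer (perSub formPer)
open B9Eq324DeltaPrimeAZdPer (deltaPrimeAPer RegularPrimePer bijective_of_form_pos)
open B9Eq325QGGQInvZdPer (QprimeStarPerInjective)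
open B9Eq335UnitaryClassCompactZd (exists_coercive_of_isCompact)
open B9Thm31CoercivePrimeCompactZd (isCompact_unitary_plaqClosed reg17Univ_of_forall_plaqF_le)
open B9Thm311PosDefOpenZd (continuous_tauForm_right)
open B9Thm311PosDefOpenRegimeZd (wcx_avgIter_lt_one_of_reg17UnivP)
open B9Thm311PosDefNearFlatZd (bgT_mem_unitaryUnits_of_reg17UnivP)
open B9SupplySockB9P3ZdAllLettersZdPer (opsLandauPer opsAllZdPer deltaAOf_opsAllZdPer_apply linearOnDomAt_opsAllZdPer_univ regularAtHPer_opsAllZdPer_of_pos)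
open B9SupplySockB9P3ZdPer (GlobAtIPer HolderAtIPer sockB9P3Per_opsAllZdPer_of_binders)
open B9Thm311OpenAtFlatHolonomyZdPer (norm_Wcx_avgIter_sub_one_lt_one_of_flat formPer_deltaPrimeAPer_self_pos_of_flat regularPrimePer_eventually_of_base
  lettersContinuousWithinAt_opsAllZdPer_of_base bondPairPer_pos_eventually_opsAllZdPer_of_flat reg17_of_flat bgT_mem_unitaryUnits_of_flat)
open B9Thm311ClassCompactnessZdPer (isClosed_isPeriodic exists_plaq_threshold_of_open_superset_flat invAtHIPer_opsAllZdPer_torusIdx)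
open B9Thm33GlobalBlockWitnessCubeZd (exists_norm_sq_le_re_trace)
open B9Thm311FlatPropagatorBoundZdPer (bondPairPer_le_young deltaAOf_gopZdHPer_of_mem)
open B8Thm4TorusAt (torusLam mem_torusLam_iff torusLam_self)
open B8Thm2TorusMember (TorusMember torusIdx torusLamb mem_torusLamb_iff)
open B8LeafModelZd3SockPer (SockB9P3Per)
open B9Eq340HolderZd (hquot AdmPair trans hquot_nonneg)

-- `Site` alone could resolve to the torus sites of `Setup.lean`; re-export the `ℤ^d` sites of `B7Prop1Explicit`.
export B7Prop1Explicit (Site)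

variable {d : ℕ} {𝔸 : Type*} [CStarAlgebra 𝔸]

/-! ## §1  The periodic coercivity engine on a compact set of backgrounds -/

section Engine

variable [FiniteDimensional ℝ 𝔸] (τ : 𝔸 →ₗ[ℂ] ℂ) {P : ℕ} [NeZero P]

/-- ★★ **UNIFORM COERCIVITY OF `⟨A, Δ_a(U₀)A⟩_per` ON A COMPACT SET OF BACKGROUNDS** (`P ≠ 0`, finite-dimensional fibre): if `Δ_a(U₀)` is (the restriction of) an
ℝ-linear map for every `U₀ ∈ 𝒰 ⊇ K`, its letters are continuous WITHIN the COMPACT `K` at every point of `K` on `E_𝔤^per(P)`, and `0 < ⟨A, Δ_a(U₀)A⟩_per` for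
every `0 ≠ A ∈ E_𝔤^per(P)` and every `U₀ ∈ K`, then ONE constant `c > 0` gives `c·⟨A, A⟩_per ≤ ⟨A, Δ_a(U₀)A⟩_per` for all `U₀ ∈ K`, `A ∈ E_𝔤^per(P)` — [4] p. 226
«Δ_a is bounded from below by a positive constant», read uniformly over a compact class (dag-n06-w4's abstract `exists_coercive_of_isCompact` on the periodic
carrier; the Dirichlet twin is `B9Eq335UnitaryClassCompactZd.exists_coercive_on_of_isCompact`).
[cite: Balaban1984PropagatorsII, p.226; Balaban1985BackgroundPropagators, Thm 3.11 p.416, (3.26)–(3.27) p.395; Balaban1985RegularSpaces, p.77 («Ω_j = T_η»)] -/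
theorem exists_coercive_per_of_isCompact {η : ℝ} {o : OpsZd d 𝔸} {𝒰 K : Set (Site d → Fin d → 𝔸ˣ)} (hK𝒰 : K ⊆ 𝒰) (hK : IsCompact K)
    (hlin : ∀ U₀ ∈ 𝒰, LinearOnDomAt η o (Set.univ : Set (Site d)) U₀)
    (hcont : ∀ U₁ ∈ K, ∀ A ∈ domSubHPer (d := d) (𝔸 := 𝔸) P, ∀ (y : Site d) (μ : Fin d), ContinuousWithinAt (fun U₀ => deltaAOf η o U₀ A y μ) K U₁)
    (hpos : ∀ U₀ ∈ K, ∀ A ∈ domSubHPer (d := d) (𝔸 := 𝔸) P, A ≠ 0 → 0 < bondPairPer τ P A (deltaAOf η o U₀ A)) :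
    ∃ c : ℝ, 0 < c ∧ ∀ U₀ ∈ K, ∀ A ∈ domSubHPer (d := d) (𝔸 := 𝔸) P, c * bondPairPer τ P A A ≤ bondPairPer τ P A (deltaAOf η o U₀ A) := by
  classical
  haveI : FiniteDimensional ℝ (domSubHPer (d := d) (𝔸 := 𝔸) P) := finiteDimensional_domSubHPer (d := d) (𝔸 := 𝔸) P
  let W : Submodule ℝ (Site d → Fin d → 𝔸) := domSubHPer (d := d) (𝔸 := 𝔸) P
  choose! T hT using hlin
  -- evaluation at a bond, as a linear map
  let ev : Site d × Fin d → ((Site d → Fin d → 𝔸) →ₗ[ℝ] 𝔸) := fun b =>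
    (LinearMap.proj (R := ℝ) (φ := fun _ : Fin d => 𝔸) b.2).comp (LinearMap.proj (R := ℝ) (φ := fun _ : Site d => Fin d → 𝔸) b.1)
  -- the bilinear forms `q U (A, B) = Σ_μ Σ_{x ∈ cell} Re τ(A(x,μ)* (T U B)(x,μ))` and `N (A, B) = Σ_μ Σ_x Re τ(A(x,μ)* B(x,μ))` on `W`
  let q : (Site d → Fin d → 𝔸ˣ) → W →ₗ[ℝ] W →ₗ[ℝ] ℝ := fun U =>
    ∑ μ : Fin d, ∑ x ∈ box (d := d) P, (tauForm τ).compl₁₂ ((ev (x, μ)).comp W.subtype) ((ev (x, μ)).comp ((T U).comp W.subtype))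
  let N : W →ₗ[ℝ] W →ₗ[ℝ] ℝ := ∑ μ : Fin d, ∑ x ∈ box (d := d) P, (tauForm τ).compl₁₂ ((ev (x, μ)).comp W.subtype) ((ev (x, μ)).comp W.subtype)
  have hq : ∀ U (A B : W), q U A B = ∑ μ : Fin d, ∑ x ∈ box (d := d) P, tauForm τ ((A : Site d → Fin d → 𝔸) x μ) (T U B x μ) := by
    intro U A B
    simp only [q, LinearMap.sum_apply, LinearMap.compl₁₂_apply, LinearMap.comp_apply, Submodule.subtype_apply, ev, LinearMap.proj_apply]
  have hN : ∀ A B : W, N A B = ∑ μ : Fin d, ∑ x ∈ box (d := d) P, tauForm τ ((A : Site d → Fin d → 𝔸) x μ) ((B : Site d → Fin d → 𝔸) x μ) := by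
    intro A B
    simp only [N, LinearMap.sum_apply, LinearMap.compl₁₂_apply, LinearMap.comp_apply, Submodule.subtype_apply, ev, LinearMap.proj_apply]
  -- on `𝒰` the entries are the periodic pairings
  have hqU : ∀ U ∈ 𝒰, ∀ A B : W, q U A B = bondPairPer τ P (A : Site d → Fin d → 𝔸) (deltaAOf η o U B) := by
    intro U hU A B
    rw [hq, bondPairPer]
    refine Finset.sum_congr rfl fun μ _ => Finset.sum_congr rfl fun x _ => ?_
    rw [tauForm_apply, hT U hU B (mem_domSub_univ _)]
  have hNA : ∀ A : W, N A A = bondPairPer τ P (A : Site d → Fin d → 𝔸) A := by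
    intro A
    rw [hN, bondPairPer]
    simp only [tauForm_apply]
  -- the entries are continuous on `K`
  have hcq : ∀ A B : W, ContinuousOn (fun U => q U A B) K := by
    intro A B U₁ hU₁
    have h : ContinuousWithinAt
        (fun U => ∑ μ : Fin d, ∑ x ∈ box (d := d) P, tauForm τ ((A : Site d → Fin d → 𝔸) x μ) (deltaAOf η o U B x μ)) K U₁ := by
      refine tendsto_finsetSum _ fun μ _ => tendsto_finsetSum _ fun x _ => ?_
      exact ((continuous_tauForm_right τ ((A : Site d → Fin d → 𝔸) x μ)).tendsto _).comp (hcont U₁ hU₁ B B.2 x μ)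
    refine h.congr (fun U hU => ?_) ?_
    · rw [hq]
      exact Finset.sum_congr rfl fun μ _ => Finset.sum_congr rfl fun x _ => by rw [hT U (hK𝒰 hU) B (mem_domSub_univ _)]
    · rw [hq]
      exact Finset.sum_congr rfl fun μ _ => Finset.sum_congr rfl fun x _ => by rw [hT U₁ (hK𝒰 hU₁) B (mem_domSub_univ _)]
  -- positivity on `K`
  have hposq : ∀ U ∈ K, ∀ A : W, A ≠ 0 → 0 < q U A A := by
    intro U hU A hA
    rw [hqU U (hK𝒰 hU) A A]
    exact hpos U hU A A.2 fun h => hA (Subtype.ext h)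
  obtain ⟨c, hc, hcoer⟩ := exists_coercive_of_isCompact q N hK hcq hposq
  refine ⟨c, hc, fun U hU A hA => ?_⟩
  have h := hcoer U hU ⟨A, hA⟩
  rwa [hqU U (hK𝒰 hU), hNA] at h

end Engine

/-! ## §2  Positivity near the flat set at the torus member (vector form, scalar form) -/

section NearFlat

variable [FiniteDimensional ℝ 𝔸] [Nontrivial 𝔸] (τ : 𝔸 →ₗ[ℂ] ℂ) (hτp : ∀ a : 𝔸, a ≠ 0 → 0 < (τ (star a * a)).re)
  (hτt : ∀ a b : 𝔸, τ (a * b) = τ (b * a)) (hτs : ∀ a : 𝔸, τ (star a) = starRingEnd ℂ (τ a)) {L P : ℕ} [NeZero P] [NeZero L]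

include hτp hτt hτs in
/-- ★★★ **POSITIVITY OF THE GENUINE PERIODIC `Δ_a(U₀)` NEAR EVERY FLAT BACKGROUND AT `torusIdx`, CANONICAL REGIME SET** — the vector form of FILE 1's
`regularAtHPer_eventually_torusIdx_canonical_of_flat`: for every flat unitary `P`-periodic `U₁`, `⟨A, Δ_a(U₀)A⟩_per > 0` on `E_𝔤^per(P) ∖ 0` for all `U₀` NEAR `U₁`
WITHIN `{unitary, P-periodic, Reg17 (α_Q∕L²), Ūʲ(Γ) unitary for j ≤ m}` (`2 ≤ L`, `Lᵐ ∣ P`).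
[cite: Balaban1985BackgroundPropagators, Thm 3.11 p.416, (3.26) p.395; Balaban1985RegularSpaces, (1.7) p.77, p.77 («Ω_j = T_η»)] -/
theorem bondPairPer_pos_eventually_torusIdx_canonical_of_flat (hL2 : 2 ≤ L) (t : TorusMember) (ops₀ : ℝ → ZdIdx d L → ℕ → OpsZd d 𝔸) (M : ℝ) (m : ℕ)
    (hP : L ^ m ∣ P) {U₁ : Site d → Fin d → 𝔸ˣ}
    (hU₁ : ∀ x κ, U₁ x κ ∈ unitaryUnits 𝔸) (hU₁per : IsPeriodic P U₁) (hflat : ∀ (κ ν : Fin d) (x : Site d), plaqF U₁ κ ν x = 1) :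
    ∀ᶠ U₀ in 𝓝[{U₀ : Site d → Fin d → 𝔸ˣ | (∀ (x : Site d) (κ : Fin d), U₀ x κ ∈ unitaryUnits 𝔸) ∧ IsPeriodic P U₀ ∧
        Reg17 L m (torusIdx (d := d) (le_trans (by norm_num) hL2) t).Ω (alphaQ d L / (L : ℝ) ^ 2) U₀ ∧
        ∀ j, j ≤ m → ∀ (x y : Site d), bgT L U₀ j x y ∈ unitaryUnits 𝔸}] U₁,
      ∀ A ∈ domSubHPer (d := d) (𝔸 := 𝔸) P, A ≠ 0 →
        0 < bondPairPer τ P A (deltaAOf t.η (opsAllZdPer τ L P (fun m => torusLamb m) ops₀ M (torusIdx (d := d) (le_trans (by norm_num) hL2) t) m) U₀ A) := by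
  have hL1 : 1 ≤ L := le_trans (by norm_num) hL2
  have hL0 : (0 : ℝ) < L := by exact_mod_cast (lt_of_lt_of_le (by norm_num) hL2)
  set i : ZdIdx d L := torusIdx (d := d) hL1 t with hi
  have hiΛ : i.Λs m = torusLam (d := d) m := rfl
  have hiΩ : ∀ j, i.Ω j = Set.univ := fun _ => rfl
  have hΛ : ∀ j, j ≤ m → IsPeriodic (P / L ^ j) fun y => y ∈ i.Λs m j := by
    intro j _ y n
    show (y + ((P / L ^ j : ℕ) : ℤ) • n ∈ i.Λs m j) = (y ∈ i.Λs m j)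
    rw [hiΛ, mem_torusLam_iff, mem_torusLam_iff]
  have hne : (i.Λs m m).Nonempty := by
    rw [hiΛ, torusLam_self]
    exact Set.univ_nonempty
  have hbox : ∀ j, 1 ≤ j → j ≤ m → ∀ c ∈ (fun m => torusLamb (d := d) m) m j, ∀ x, InBox (loK L j c.1) (bondHiK L j c.1 c.2) x → x ∈ i.Ω (j - 1) :=
    fun j _ _ _ _ x _ => by rw [hiΩ]; exact Set.mem_univ x
  have hinj : ∀ U₀ ∈ {U₀ : Site d → Fin d → 𝔸ˣ | (∀ (x : Site d) (κ : Fin d), U₀ x κ ∈ unitaryUnits 𝔸) ∧ IsPeriodic P U₀ ∧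
        Reg17 L m i.Ω (alphaQ d L / (L : ℝ) ^ 2) U₀ ∧ ∀ j, j ≤ m → ∀ (x y : Site d), bgT L U₀ j x y ∈ unitaryUnits 𝔸},
      QprimeStarPerInjective (𝔸 := 𝔸) (d := d) P L U₀ m (i.Λs m) := by
    intro U₀ _
    refine B9Eq325QGGQInvZdPer.qprimeStarPerInjective_of_single_level hP le_rfl fun j _ hjm y hsat => hjm ?_
    unfold B9Eq325QGGQInvZdPer.InSat at hsat
    rw [hiΛ, mem_torusLam_iff] at hsat
    exact hsat
  have hposU₁ : ∀ A ∈ domSubHPer (d := d) (𝔸 := 𝔸) P, A ≠ 0 →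
      0 < bondPairPer τ P A (deltaAOf i.η (opsAllZdPer τ L P (fun m => torusLamb (d := d) m) ops₀ M i m) U₁ A) :=
    fun A hA hA0 => B9Thm311FlatHolonomyKernelZdPer.bondPairPer_deltaAOf_opsAllZdPer_pos_of_flat τ P hτt hτs hτp hL2 ops₀ M i hiΛ rfl hiΩ hP
      hU₁ hU₁per hflat hA hA0
  have h1 : U₁ ∈ {U₀ : Site d → Fin d → 𝔸ˣ | (∀ (x : Site d) (κ : Fin d), U₀ x κ ∈ unitaryUnits 𝔸) ∧ IsPeriodic P U₀ ∧
      Reg17 L m i.Ω (alphaQ d L / (L : ℝ) ^ 2) U₀ ∧ ∀ j, j ≤ m → ∀ (x y : Site d), bgT L U₀ j x y ∈ unitaryUnits 𝔸} :=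
    ⟨hU₁, hU₁per, reg17_of_flat hL1 m _ (div_pos (alphaQ_pos d hL1) (pow_pos hL0 2)) hflat, fun j _ x y => bgT_mem_unitaryUnits_of_flat L hU₁ hflat j x y⟩
  have h := bondPairPer_pos_eventually_opsAllZdPer_of_flat τ hτp hτt hτs hL2 (fun m => torusLamb (d := d) m) ops₀ M i m hP hΛ le_rfl hne hbox h1 hU₁ hU₁per
    hflat (fun U₀ hU₀ => hU₀.1) (fun U₀ hU₀ => hU₀.2.1) (fun U₀ hU₀ => hU₀.2.2.1) (fun U₀ hU₀ => hU₀.2.2.2) hinj hposU₁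
  have hiη : i.η = t.η := rfl
  rw [hiη] at h
  exact h

omit [Nontrivial 𝔸] in
include hτp hτt in
/-- ★★ **THE SCALAR FORM `⟨f, Δ′_a(U₀)f⟩_{T_P} > 0` NEAR EVERY FLAT PERIODIC BACKGROUND, IN THE FULL NEIGHBOURHOOD FILTER** (weights `a ≡ 1`, constraint sets
`torusLam m`, `η ≠ 0`, `1 ≤ L`, `Lᵐ ∣ P`): FILE 1's `regularPrimePer_eventually_of_base` at a flat `U₁` (disc condition and scalar positivity at `U₁` are FILE 1's
§1–§2), within `𝒰 = univ`. [cite: Balaban1985BackgroundPropagators, Thm 3.11 p.416 («Δ′_a … positive definite»), (3.24) p.394] -/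
theorem scalarPos_eventually_of_flat {η : ℝ} (hη : η ≠ 0) (hL1 : 1 ≤ L) (m : ℕ) (hP : L ^ m ∣ P) {U₁ : Site d → Fin d → 𝔸ˣ}
    (hU₁ : ∀ x κ, U₁ x κ ∈ unitaryUnits 𝔸) (hU₁per : IsPeriodic P U₁) (hflat : ∀ (κ ν : Fin d) (x : Site d), plaqF U₁ κ ν x = 1) :
    ∀ᶠ U₀ in 𝓝 U₁, ∀ f : perSub (𝔸 := 𝔸) (d := d) P, f ≠ 0 →
      0 < formPer τ P f (deltaPrimeAPer L U₀ η m (fun _ => (1 : ℝ)) (torusLam (d := d) m) P f) := by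
  have hΛ₀ : IsPeriodic (P / L ^ m) fun y => y ∈ torusLam (d := d) m m := by
    intro y n
    show (y + ((P / L ^ m : ℕ) : ℤ) • n ∈ torusLam (d := d) m m) = (y ∈ torusLam (d := d) m m)
    rw [mem_torusLam_iff, mem_torusLam_iff]
  have hne : (torusLam (d := d) m m).Nonempty := by
    rw [torusLam_self]
    exact Set.univ_nonempty
  have hposS : ∀ f : perSub (𝔸 := 𝔸) (d := d) P, f ≠ 0 → 0 < formPer τ P f (deltaPrimeAPer L U₁ η m (fun _ => (1 : ℝ)) (torusLam (d := d) m) P f) :=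
    fun f hf => formPer_deltaPrimeAPer_self_pos_of_flat τ hη hL1 hτt hτp hP (fun _ => zero_le_one) le_rfl zero_lt_one hΛ₀ hne hU₁ hU₁per hflat hf
  have h := regularPrimePer_eventually_of_base τ (fun i' _ q κ r => norm_Wcx_avgIter_sub_one_lt_one_of_flat L hU₁ hflat i' q κ r) hposS
    (Set.univ : Set (Site d → Fin d → 𝔸ˣ)) (η := η) (m := m) (a := fun _ => (1 : ℝ)) (Λs := torusLam (d := d) m)
  rw [nhdsWithin_univ] at h
  exact h.mono fun U₀ hU₀ => hU₀.1

end NearFlat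

/-! ## §3  Uniform coercivity and regularity on the compact small-plaquette class at the torus member -/

section Coercive

variable [FiniteDimensional ℝ 𝔸] [Nontrivial 𝔸] (τ : 𝔸 →ₗ[ℂ] ℂ) (hτp : ∀ a : 𝔸, a ≠ 0 → 0 < (τ (star a * a)).re)
  (hτt : ∀ a b : 𝔸, τ (a * b) = τ (b * a)) (hτs : ∀ a : 𝔸, τ (star a) = starRingEnd ℂ (τ a)) {L P : ℕ} [NeZero P] [NeZero L]

include hτp hτt hτs in
/-- ★★★★ **[4] p. 226 «Δ_a IS BOUNDED FROM BELOW BY A POSITIVE CONSTANT» ON THE TORUS, PER MEMBER, FOR THE WHOLE CLOSED SMALL-PLAQUETTE CLASS AT ONCE.**  For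
`0 < d`, `2 ≤ L`, `Lᵐ ∣ P` and a faithful Hermitian tracial `τ` on a finite-dimensional non-trivial fibre there are `α > 0` and `c > 0` such that EVERY unitary
`P`-periodic background `U₀` ALL of whose plaquette variables are `α`-close to `1` has, for the genuine periodic record at `torusIdx`: `RegularAtHPer`
(`G_𝔤^per(U₀)` exists) AND `c·⟨A, A⟩_per ≤ ⟨A, Δ_a(U₀)A⟩_per` for every `A ∈ E_𝔤^per(P)`.  Proof: the swallowing lemma (FILE 2) for the JOINT property «(canonical
regime ⟹ vector positivity) ∧ scalar positivity» (both neighbourhoods of the flat set by §2) gives `α₁`; `α := min α₁ ((α_Q∕L²)·L^{−2m}∕2)` puts the compact class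
`{unitary, P-periodic, plaquettes α-close}` inside the canonical regime (`reg17Univ_of_forall_plaqF_le`, [B7] Prop. 2) and inside `{RegularPrimePer}`; there the
letters are continuous within (FILE 1 `…_of_base`, disc condition by `wcx_avgIter_lt_one_of_reg17UnivP`), and §1 applies.
[cite: Balaban1984PropagatorsII, p.226; Balaban1985BackgroundPropagators, Thm 3.11 p.416, (3.26)–(3.27) p.395; Balaban1985RegularSpaces, (1.7) p.77, p.77 («Ω_j = T_η»); Balaban1985Averaging, Prop. 2 p.26] -/
theorem exists_coercive_plaqNear_torusIdx (hd : 0 < d) (hL2 : 2 ≤ L) (t : TorusMember) (ops₀ : ℝ → ZdIdx d L → ℕ → OpsZd d 𝔸) (M : ℝ) (m : ℕ)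
    (hP : L ^ m ∣ P) :
    ∃ α : ℝ, 0 < α ∧ ∃ c : ℝ, 0 < c ∧ ∀ U₀ : Site d → Fin d → 𝔸ˣ, (∀ (x : Site d) (κ : Fin d), U₀ x κ ∈ unitaryUnits 𝔸) → IsPeriodic P U₀ →
      (∀ (x : Site d) (κ ν : Fin d), ‖plaqF U₀ κ ν x - 1‖ ≤ α) →
        RegularAtHPer t.η (opsLandauPer τ P (withDpZd (withQQP τ L (fun m => torusLamb m) ops₀)) M (torusIdx (d := d) (le_trans (by norm_num) hL2) t) m) P U₀ ∧
        ∀ A ∈ domSubHPer (d := d) (𝔸 := 𝔸) P,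
          c * bondPairPer τ P A A ≤
            bondPairPer τ P A (deltaAOf t.η (opsAllZdPer τ L P (fun m => torusLamb m) ops₀ M (torusIdx (d := d) (le_trans (by norm_num) hL2) t) m) U₀ A) := by
  have hL1 : 1 ≤ L := le_trans (by norm_num) hL2
  have hL0 : (0 : ℝ) < L := by exact_mod_cast (lt_of_lt_of_le (by norm_num) hL2)
  set i : ZdIdx d L := torusIdx (d := d) hL1 t with hi
  have hiΛ : i.Λs m = torusLam (d := d) m := rfl
  have hiΩ : ∀ j, i.Ω j = Set.univ := fun _ => rfl
  have hiη : i.η = t.η := rfl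
  -- geometry at the torus member
  have hΛ : ∀ j, j ≤ m → IsPeriodic (P / L ^ j) fun y => y ∈ i.Λs m j := by
    intro j _ y n
    show (y + ((P / L ^ j : ℕ) : ℤ) • n ∈ i.Λs m j) = (y ∈ i.Λs m j)
    rw [hiΛ, mem_torusLam_iff, mem_torusLam_iff]
  have hΛb : ∀ j, j ≤ m → ∀ κ : Fin d, IsPeriodic (P / L ^ j) (fun z => (z, κ) ∈ (fun m => torusLamb (d := d) m) m j) := by
    intro j _ κ z n
    show ((z + ((P / L ^ j : ℕ) : ℤ) • n, κ) ∈ torusLamb (d := d) m j) = ((z, κ) ∈ torusLamb (d := d) m j)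
    rw [mem_torusLamb_iff, mem_torusLamb_iff]
  have hbox : ∀ j, 1 ≤ j → j ≤ m → ∀ c ∈ (fun m => torusLamb (d := d) m) m j, ∀ x, InBox (loK L j c.1) (bondHiK L j c.1 c.2) x → x ∈ i.Ω (j - 1) :=
    fun j _ _ _ _ x _ => by rw [hiΩ]; exact Set.mem_univ x
  have hinj : ∀ U₀ : Site d → Fin d → 𝔸ˣ, QprimeStarPerInjective (𝔸 := 𝔸) (d := d) P L U₀ m (i.Λs m) := by
    intro U₀
    refine B9Eq325QGGQInvZdPer.qprimeStarPerInjective_of_single_level hP le_rfl fun j _ hjm y hsat => hjm ?_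
    unfold B9Eq325QGGQInvZdPer.InSat at hsat
    rw [hiΛ, mem_torusLam_iff] at hsat
    exact hsat
  -- the canonical regime set, the two positivity properties and the joint good set
  set 𝒰 : Set (Site d → Fin d → 𝔸ˣ) := {U₀ | (∀ (x : Site d) (κ : Fin d), U₀ x κ ∈ unitaryUnits 𝔸) ∧ IsPeriodic P U₀ ∧
      Reg17 L m i.Ω (alphaQ d L / (L : ℝ) ^ 2) U₀ ∧ ∀ j, j ≤ m → ∀ (x y : Site d), bgT L U₀ j x y ∈ unitaryUnits 𝔸} with h𝒰
  set PosV : (Site d → Fin d → 𝔸ˣ) → Prop := fun U₀ => ∀ A ∈ domSubHPer (d := d) (𝔸 := 𝔸) P, A ≠ 0 →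
      0 < bondPairPer τ P A (deltaAOf t.η (opsAllZdPer τ L P (fun m => torusLamb m) ops₀ M i m) U₀ A) with hPosV
  set PosS : (Site d → Fin d → 𝔸ˣ) → Prop := fun U₀ => ∀ f : perSub (𝔸 := 𝔸) (d := d) P, f ≠ 0 →
      0 < formPer τ P f (deltaPrimeAPer L U₀ t.η m (fun _ => (1 : ℝ)) (torusLam (d := d) m) P f) with hPosS
  set N₀ : Set (Site d → Fin d → 𝔸ˣ) := interior {U₀ | (U₀ ∈ 𝒰 → PosV U₀) ∧ PosS U₀} with hN₀
  have hN₀open : IsOpen N₀ := isOpen_interior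
  have hflatN : ∀ U : Site d → Fin d → 𝔸ˣ, (∀ (x : Site d) (κ : Fin d), U x κ ∈ unitaryUnits 𝔸) → IsPeriodic P U →
      (∀ (κ ν : Fin d) (x : Site d), plaqF U κ ν x = 1) → U ∈ N₀ := by
    intro U hUu hUp hUf
    have h1 := bondPairPer_pos_eventually_torusIdx_canonical_of_flat τ hτp hτt hτs hL2 t ops₀ M m hP hUu hUp hUf
    rw [eventually_nhdsWithin_iff] at h1
    have h2 := scalarPos_eventually_of_flat τ hτp hτt t.hη.ne' hL1 m hP hUu hUp hUf
    refine mem_interior_iff_mem_nhds.2 (Filter.mem_of_superset (Filter.inter_mem h1 h2) fun U₀ hU₀ => ?_)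
    exact ⟨fun h𝒰 => hU₀.1 h𝒰, hU₀.2⟩
  obtain ⟨α₁, hα₁, hswallow⟩ := exists_plaq_threshold_of_open_superset_flat P hN₀open hflatN
  -- the threshold: inside the swallowed set and strictly inside the class (1.7) at window `α_Q∕L²`
  obtain ⟨β, hβ_def⟩ : ∃ β : ℝ, β = alphaQ d L / (L : ℝ) ^ 2 * (((L : ℝ) ^ m)⁻¹) ^ 2 := ⟨_, rfl⟩
  have hβ : 0 < β := by rw [hβ_def]; exact mul_pos (div_pos (alphaQ_pos d hL1) (pow_pos hL0 2)) (by positivity)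
  set α : ℝ := min α₁ (β / 2) with hα
  have hα0 : 0 < α := lt_min hα₁ (by positivity)
  have hαβ : α < β := (min_le_right _ _).trans_lt (by linarith)
  -- the compact class
  set K : Set (Site d → Fin d → 𝔸ˣ) := {U₀ | (∀ x κ, U₀ x κ ∈ unitaryUnits 𝔸) ∧ ∀ (x : Site d) (μ ν : Fin d), ‖plaqF U₀ μ ν x - 1‖ ≤ α} ∩
      {U₀ | IsPeriodic P U₀} with hK
  have hKc : IsCompact K := (isCompact_unitary_plaqClosed α).inter_right (isClosed_isPeriodic P)
  have hKreg : ∀ U₀ ∈ K, Reg17 L m (fun _ => (Set.univ : Set (Site d))) (alphaQ d L / (L : ℝ) ^ 2) U₀ := by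
    intro U₀ hU₀
    exact reg17Univ_of_forall_plaqF_le hL1 m (by rw [← hβ_def]; exact hαβ) hU₀.1.2
  have hK𝒰 : K ⊆ 𝒰 := fun U₀ hU₀ =>
    ⟨hU₀.1.1, hU₀.2, hKreg U₀ hU₀, bgT_mem_unitaryUnits_of_reg17UnivP hd hL2 m hU₀.1.1 (hKreg U₀ hU₀)⟩
  have hKN : K ⊆ N₀ := fun U₀ hU₀ => hswallow U₀ hU₀.1.1 hU₀.2 fun x κ ν => (hU₀.1.2 x κ ν).trans (min_le_left _ _)
  have hKgood : ∀ U₀ ∈ K, PosV U₀ ∧ PosS U₀ := fun U₀ hU₀ =>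
    ⟨(interior_subset (hKN hU₀)).1 (hK𝒰 hU₀), (interior_subset (hKN hU₀)).2⟩
  -- the refined regime set on which the `D R^per D*` letter is continuous
  set 𝒰' : Set (Site d → Fin d → 𝔸ˣ) := 𝒰 ∩ {U₀ | RegularPrimePer L U₀ i.η m (fun _ => (1 : ℝ)) (i.Λs m) P} with h𝒰'
  have hK𝒰' : K ⊆ 𝒰' := fun U₀ hU₀ => ⟨hK𝒰 hU₀, bijective_of_form_pos τ (hKgood U₀ hU₀).2⟩
  have hlin : ∀ U₀ ∈ 𝒰', LinearOnDomAt i.η (opsAllZdPer τ L P (fun m => torusLamb (d := d) m) ops₀ M i m) (Set.univ : Set (Site d)) U₀ :=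
    fun U₀ hU₀ => linearOnDomAt_opsAllZdPer_univ τ P hL2 (fun m => torusLamb (d := d) m) ops₀ M i m hbox hU₀.1.1
  have hcont : ∀ U₁ ∈ K, ∀ A ∈ domSubHPer (d := d) (𝔸 := 𝔸) P, ∀ (y : Site d) (μ : Fin d),
      ContinuousWithinAt (fun U₀ => deltaAOf i.η (opsAllZdPer τ L P (fun m => torusLamb (d := d) m) ops₀ M i m) U₀ A y μ) K U₁ := by
    intro U₁ hU₁ A hA y μ
    have hsmall : ∀ i', i' < m + 1 → ∀ (q : Site d) (κ : Fin d) (r : Fin d → Fin L),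
        ‖((Wcx L (avgIter L U₁ i') q κ (boxVec L r) : 𝔸ˣ) : 𝔸) - 1‖ < 1 :=
      fun i' hi' q κ r => wcx_avgIter_lt_one_of_reg17UnivP hd hL2 m hU₁.1.1 (hKreg U₁ hU₁) i' (Nat.lt_succ_iff.1 hi') q κ r
    have h := lettersContinuousWithinAt_opsAllZdPer_of_base τ hτp hτt hτs (fun m => torusLamb (d := d) m) ops₀ M i m (fun _ => (1 : ℝ)) hL1 hP hΛ
      (hK𝒰' hU₁) hsmall (fun U hU => hU.1.1) (fun U hU => hU.1.2.1) (fun U hU => hU.1.2.2.1) (fun U hU => hU.1.2.2.2) (fun U hU => hU.2)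
      (fun U _ => hinj U) hA y μ
    exact h.mono hK𝒰'
  have hpos : ∀ U₀ ∈ K, ∀ A ∈ domSubHPer (d := d) (𝔸 := 𝔸) P, A ≠ 0 →
      0 < bondPairPer τ P A (deltaAOf i.η (opsAllZdPer τ L P (fun m => torusLamb (d := d) m) ops₀ M i m) U₀ A) :=
    fun U₀ hU₀ => (hKgood U₀ hU₀).1
  obtain ⟨c, hc, hcoer⟩ := exists_coercive_per_of_isCompact τ hK𝒰' hKc hlin hcont hpos
  refine ⟨α, hα0, c, hc, fun U₀ hU₀ hper hnear => ?_⟩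
  have hUK : U₀ ∈ K := ⟨⟨hU₀, fun x μ ν => hnear x μ ν⟩, hper⟩
  refine ⟨?_, fun A hA => hcoer U₀ hUK A hA⟩
  have h := regularAtHPer_opsAllZdPer_of_pos τ P hL2 hτp hτt hτs (fun m => torusLamb (d := d) m) ops₀ M i hU₀ hper hP hΛb hbox (hpos U₀ hUK)
  rw [hiη] at h
  exact h

end Coercive

/-! ## §4  The pointwise bound `‖(G_𝔤^per(U₀)J)(b)‖ ≤ N·|J|₍₋₃₎` on the class ([4] (2.22) + the fibre comparison) -/

section Pointwise

variable [FiniteDimensional ℝ 𝔸] [Nontrivial 𝔸] (τ : 𝔸 →ₗ[ℂ] ℂ) (hτp : ∀ a : 𝔸, a ≠ 0 → 0 < (τ (star a * a)).re)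
  (hτt : ∀ a b : 𝔸, τ (a * b) = τ (b * a)) (hτs : ∀ a : 𝔸, τ (star a) = starRingEnd ℂ (τ a)) {L P : ℕ} [NeZero P] [NeZero L]

omit [FiniteDimensional ℝ 𝔸] [Nontrivial 𝔸] [NeZero L] in
/-- **A PERIODIC BOND FIELD'S `|·|₍₋₃₎`-FAMILY OVER ALL BONDS OF `ℤᵈ` IS BOUNDED, AND `η³‖J(b)‖ ≤ |J|₍₋₃₎` AT EVERY BOND** (`Ω_j = ℤᵈ`; the weights `(Lʲη)³ ≤ (Lᵐη)³`,
the values of a `P`-periodic field lie among its values on one period cell — lit-balaban t2s's `norm_le_sum_box_of_isPeriodic`).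
[cite: Balaban1985RegularSpaces, p.86 (definition of `|·|_{(γ)}`), p.77 («Ω_j = T_η»); Balaban1985BackgroundPropagators, (3.41) p.397] -/
theorem eta_cube_mul_norm_le_bondNorm_per (hL : 1 ≤ L) (m : ℕ) {η : ℝ} (hη : 0 < η) {J : Site d → Fin d → 𝔸} (hJ : IsPeriodic P J)
    (y : Site d) (μ : Fin d) :
    η ^ 3 * ‖J y μ‖ ≤ bondNorm L m η (-(3 : ℝ)) (fun _ => (Set.univ : Set (Site d))) J := by
  classical
  have e3 : (-(3 : ℝ)) = -((3 : ℕ) : ℝ) := by norm_num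
  have hLr : (1 : ℝ) ≤ L := by exact_mod_cast hL
  -- boundedness from periodicity
  have hbd : ∀ b : Site d × Fin d, ‖J b.1 b.2‖ ≤ ∑ κ : Fin d, ∑ ξ : Fin d → ZMod P, ‖J (tlift ξ) κ‖ := by
    rintro ⟨x, κ⟩
    calc ‖J x κ‖ ≤ ∑ ξ : Fin d → ZMod P, ‖J (tlift ξ) κ‖ := B9B8KnitHolderZeroOfGlob.norm_le_sum_box_of_isPeriodic (isPeriodic_apply_dir hJ κ) x
      _ ≤ ∑ κ' : Fin d, ∑ ξ : Fin d → ZMod P, ‖J (tlift ξ) κ'‖ :=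
          Finset.single_le_sum (f := fun κ' : Fin d => ∑ ξ : Fin d → ZMod P, ‖J (tlift ξ) κ'‖)
            (fun _ _ => Finset.sum_nonneg fun _ _ => norm_nonneg _) (Finset.mem_univ κ)
  have hBdd : Bdd L m η (-(3 : ℝ)) (fun j (b : Site d × Fin d) => BondTouches ((fun _ => (Set.univ : Set (Site d))) j) b.1 b.2) (fun b => J b.1 b.2) := by
    refine B8ScaledSupNorm.bdd_of_forall (c := ((L : ℝ) ^ m * η) ^ 3 * ∑ κ : Fin d, ∑ ξ : Fin d → ZMod P, ‖J (tlift ξ) κ‖) fun j hj b _ => ?_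
    rw [e3, B8ScaledSupNorm.weight_neg_natCast]
    have hw : ((L : ℝ) ^ j * η) ^ 3 ≤ ((L : ℝ) ^ m * η) ^ 3 := by
      apply pow_le_pow_left₀ (by positivity)
      exact mul_le_mul_of_nonneg_right (pow_le_pow_right₀ hLr hj) hη.le
    exact mul_le_mul hw (hbd b) (norm_nonneg _) (by positivity)
  have h := B8ScaledSupNorm.weight_mul_norm_le_msup hBdd (Nat.zero_le m) (i := (y, μ)) (Or.inl (Set.mem_univ y))
  rw [e3, B8ScaledSupNorm.weight_neg_natCast, pow_zero, one_mul] at h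
  exact h

include hτp hτt hτs in
/-- ★★★ **A SUP-NORM BOUND FOR THE GENUINE PERIODIC PROPAGATOR ON THE CLOSED SMALL-PLAQUETTE CLASS, PER MEMBER**: `∃ α > 0, ∃ N ≥ 0`: every unitary `P`-periodic `U₀`
whose plaquette variables are all `α`-close to `1`, every periodic Hermitian `J`, every bond `b`: `RegularAtHPer` and `‖(G_𝔤^per(U₀)J)(b)‖ ≤ N·|J|₍₋₃₎` — [4] (2.22)
(`⟨A, A⟩_per ≤ c⁻²⟨J, J⟩_per` for `A = G_𝔤^per(U₀)J` from §3's coercivity, Young's inequality (dag-n06-w3) and `Δ_a(U₀)A = J`) plus the finite-dimensional comparison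
`κ‖a‖² ≤ Re τ(a*a)` and `|Re τ(x*y)| ≤ C_τ‖x‖‖y‖` on the `d·Pᵈ` bonds of the period cell.
[cite: Balaban1984PropagatorsII, (2.22) p.226; Balaban1985BackgroundPropagators, Thm 3.3 p.399, (3.47) p.398, (3.27) p.395; Balaban1985RegularSpaces, p.77 («Ω_j = T_η»)] -/
theorem exists_apply_bound_gopZdHPer_plaqNear_torusIdx (hd : 0 < d) (hL2 : 2 ≤ L) {Cτ : ℝ} (hCτ : ∀ x y : 𝔸, |(τ (star x * y)).re| ≤ Cτ * ‖x‖ * ‖y‖)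
    (t : TorusMember) (ops₀ : ℝ → ZdIdx d L → ℕ → OpsZd d 𝔸) (M : ℝ) (m : ℕ) (hP : L ^ m ∣ P) :
    ∃ α : ℝ, 0 < α ∧ ∃ N : ℝ, 0 ≤ N ∧ ∀ U₀ : Site d → Fin d → 𝔸ˣ, (∀ (x : Site d) (κ : Fin d), U₀ x κ ∈ unitaryUnits 𝔸) → IsPeriodic P U₀ →
      (∀ (x : Site d) (κ ν : Fin d), ‖plaqF U₀ κ ν x - 1‖ ≤ α) →
        RegularAtHPer t.η (opsLandauPer τ P (withDpZd (withQQP τ L (fun m => torusLamb m) ops₀)) M (torusIdx (d := d) (le_trans (by norm_num) hL2) t) m) P U₀ ∧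
        ∀ J : Site d → Fin d → 𝔸, J ∈ domSubHPer (d := d) (𝔸 := 𝔸) P → ∀ (y : Site d) (μ : Fin d),
          ‖gopZdHPer t.η (opsLandauPer τ P (withDpZd (withQQP τ L (fun m => torusLamb m) ops₀)) M (torusIdx (d := d) (le_trans (by norm_num) hL2) t) m) P U₀ J y μ‖ ≤
            N * bondNorm L m t.η (-(3 : ℝ)) (fun _ => (Set.univ : Set (Site d))) J := by
  classical
  have hL1 : 1 ≤ L := le_trans (by norm_num) hL2
  have hη : 0 < t.η := t.hη
  set i : ZdIdx d L := torusIdx (d := d) hL1 t with hi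
  obtain ⟨α, hα, c, hc, h⟩ := exists_coercive_plaqNear_torusIdx τ hτp hτt hτs hd hL2 t ops₀ M m hP
  obtain ⟨κ, hκ, hκle⟩ := exists_norm_sq_le_re_trace τ hτp
  have hCτ0 : 0 ≤ Cτ := by
    have h1 := hCτ 1 1
    rw [star_one, one_mul, norm_one, mul_one, mul_one] at h1
    exact le_trans (abs_nonneg _) h1
  -- the constant: `‖A(b)‖² ≤ K·(η⁻³|J|)²` with `K = d·#cell·C_τ∕(κc²)`
  obtain ⟨K, hK_def⟩ : ∃ K : ℝ, K = (d : ℝ) * ((box (d := d) P).card : ℝ) * Cτ / (κ * c ^ 2) := ⟨_, rfl⟩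
  have hK0 : 0 ≤ K := by rw [hK_def]; positivity
  refine ⟨α, hα, max 1 K * t.η⁻¹ ^ 3, by positivity, fun U₀ hU₀ hper hnear => ?_⟩
  obtain ⟨hreg, hcoer⟩ := h U₀ hU₀ hper hnear
  refine ⟨hreg, fun J hJ y μ => ?_⟩
  set o : OpsZd d 𝔸 := opsLandauPer τ P (withDpZd (withQQP τ L (fun m => torusLamb (d := d) m) ops₀)) M i m with ho
  obtain ⟨A, hA_def⟩ : ∃ A : Site d → Fin d → 𝔸, A = gopZdHPer t.η o P U₀ J := ⟨_, rfl⟩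
  obtain ⟨nJ, hnJ_def⟩ : ∃ nJ : ℝ, nJ = bondNorm L m t.η (-(3 : ℝ)) (fun _ => (Set.univ : Set (Site d))) J := ⟨_, rfl⟩
  rw [← hA_def, ← hnJ_def]
  have hnJ0 : 0 ≤ nJ := by rw [hnJ_def]; exact B8ScaledSupNorm.msup_nonneg L m hη.le _ _ _
  have hAmem : A ∈ domSubHPer (d := d) (𝔸 := 𝔸) P := by rw [hA_def]; exact gopZdHPer_mem_domSubHPer t.η o P U₀ J
  have hAper : IsPeriodic P A := ((mem_domSubHPer_iff P A).1 hAmem).1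
  -- (3.27): `Δ_a(U₀)A = J`
  have hΔA : deltaAOf t.η o U₀ A = J := by rw [hA_def]; exact deltaAOf_gopZdHPer_of_mem P hreg hJ
  -- coercivity at `A` and Young: ⟨A, A⟩ ≤ c⁻² ⟨J, J⟩
  have hcA : c * bondPairPer τ P A A ≤ bondPairPer τ P A J := by
    have h1 := hcoer A hAmem
    rw [show deltaAOf t.η (opsAllZdPer τ L P (fun m => torusLamb (d := d) m) ops₀ M i m) U₀ A = deltaAOf t.η o U₀ A from rfl, hΔA] at h1
    exact h1
  have hyoung := bondPairPer_le_young τ P hτs hτp A J hc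
  have hJJ0 : 0 ≤ bondPairPer τ P J J :=
    Finset.sum_nonneg fun μ _ => Finset.sum_nonneg fun x _ => B9Thm311FlatHermKernelZd.re_trace_star_mul_self_nonneg' hτp _
  have hAA0 : 0 ≤ bondPairPer τ P A A :=
    Finset.sum_nonneg fun μ _ => Finset.sum_nonneg fun x _ => B9Thm311FlatHermKernelZd.re_trace_star_mul_self_nonneg' hτp _
  have hAA : bondPairPer τ P A A ≤ c⁻¹ ^ 2 * bondPairPer τ P J J := by
    -- `c·X ≤ (c/2)·X + (1/(2c))·Y` ⟹ `X ≤ Y/c²`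
    have h2 : c * bondPairPer τ P A A ≤ c / 2 * bondPairPer τ P A A + 1 / (2 * c) * bondPairPer τ P J J := hcA.trans hyoung
    have h3 : c / 2 * bondPairPer τ P A A ≤ 1 / (2 * c) * bondPairPer τ P J J := by linarith
    have hc2 : 0 < c / 2 := by positivity
    have h4 : 2 / c * (c / 2 * bondPairPer τ P A A) ≤ 2 / c * (1 / (2 * c) * bondPairPer τ P J J) := mul_le_mul_of_nonneg_left h3 (by positivity)
    have e1 : 2 / c * (c / 2 * bondPairPer τ P A A) = bondPairPer τ P A A := by field_simp
    have e2 : 2 / c * (1 / (2 * c) * bondPairPer τ P J J) = c⁻¹ ^ 2 * bondPairPer τ P J J := by field_simp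
    rw [e1, e2] at h4
    exact h4
  -- ‖J(b)‖ ≤ η⁻³|J| everywhere
  have hJb : ∀ (x : Site d) (κ' : Fin d), ‖J x κ'‖ ≤ t.η⁻¹ ^ 3 * nJ := by
    intro x κ'
    have h1 := eta_cube_mul_norm_le_bondNorm_per (𝔸 := 𝔸) (P := P) hL1 m hη ((mem_domSubHPer_iff P J).1 hJ).1 x κ'
    rw [← hnJ_def] at h1
    have hη3 : 0 < t.η ^ 3 := by positivity
    rw [inv_pow, ← div_eq_inv_mul, le_div_iff₀ hη3]
    linarith [h1]
  -- ⟨J, J⟩ ≤ d·#cell·C_τ·(η⁻³|J|)²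
  have hJJ : bondPairPer τ P J J ≤ (d : ℝ) * ((box (d := d) P).card : ℝ) * (Cτ * (t.η⁻¹ ^ 3 * nJ) ^ 2) := by
    have hterm : ∀ (μ' : Fin d) (x : Site d), (τ (star (J x μ') * J x μ')).re ≤ Cτ * (t.η⁻¹ ^ 3 * nJ) ^ 2 := by
      intro μ' x
      calc (τ (star (J x μ') * J x μ')).re ≤ Cτ * ‖J x μ'‖ * ‖J x μ'‖ := (le_abs_self _).trans (hCτ _ _)
        _ ≤ Cτ * (t.η⁻¹ ^ 3 * nJ) * (t.η⁻¹ ^ 3 * nJ) := by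
            apply mul_le_mul (mul_le_mul_of_nonneg_left (hJb x μ') hCτ0) (hJb x μ') (norm_nonneg _) (by positivity)
        _ = Cτ * (t.η⁻¹ ^ 3 * nJ) ^ 2 := by ring
    calc bondPairPer τ P J J = ∑ μ' : Fin d, ∑ x ∈ box (d := d) P, (τ (star (J x μ') * J x μ')).re := rfl
      _ ≤ ∑ μ' : Fin d, ∑ x ∈ box (d := d) P, Cτ * (t.η⁻¹ ^ 3 * nJ) ^ 2 :=
          Finset.sum_le_sum fun μ' _ => Finset.sum_le_sum fun x _ => hterm μ' x
      _ = (d : ℝ) * ((box (d := d) P).card : ℝ) * (Cτ * (t.η⁻¹ ^ 3 * nJ) ^ 2) := by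
          rw [Finset.sum_const, Finset.sum_const, Finset.card_univ, Fintype.card_fin, nsmul_eq_mul, nsmul_eq_mul]; ring
  -- κ‖A(b)‖² ≤ ⟨A, A⟩ (move `b` into the period cell by periodicity)
  have hx₀ : tlift (tcls P y) ∈ box (d := d) P := tlift_mem_box _
  have hAy : A y μ = A (tlift (tcls P y)) μ := by rw [show A (tlift (tcls P y)) = A y from hAper.apply_tlift y]
  have h1 : κ * ‖A y μ‖ ^ 2 ≤ bondPairPer τ P A A := by
    rw [hAy]
    refine (hκle (A (tlift (tcls P y)) μ)).trans ?_
    have hterm : ∀ (μ' : Fin d), ∀ x ∈ box (d := d) P, 0 ≤ (τ (star (A x μ') * A x μ')).re :=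
      fun μ' x _ => B9Thm311FlatHermKernelZd.re_trace_star_mul_self_nonneg' hτp _
    calc (τ (star (A (tlift (tcls P y)) μ) * A (tlift (tcls P y)) μ)).re
        ≤ ∑ x ∈ box (d := d) P, (τ (star (A x μ) * A x μ)).re :=
          Finset.single_le_sum (f := fun x => (τ (star (A x μ) * A x μ)).re) (hterm μ) hx₀
      _ ≤ ∑ μ' : Fin d, ∑ x ∈ box (d := d) P, (τ (star (A x μ') * A x μ')).re :=
          Finset.single_le_sum (f := fun μ' : Fin d => ∑ x ∈ box (d := d) P, (τ (star (A x μ') * A x μ')).re)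
            (fun μ' _ => Finset.sum_nonneg (hterm μ')) (Finset.mem_univ μ)
      _ = bondPairPer τ P A A := rfl
  -- combine
  have hc2 : 0 < κ * c ^ 2 := by positivity
  have h2 : ‖A y μ‖ ^ 2 ≤ K * (t.η⁻¹ ^ 3 * nJ) ^ 2 := by
    rw [hK_def, div_mul_eq_mul_div, le_div_iff₀ hc2]
    have h3 : κ * c ^ 2 * ‖A y μ‖ ^ 2 ≤ c ^ 2 * bondPairPer τ P A A := by nlinarith [h1, sq_nonneg c]
    have h4 : c ^ 2 * bondPairPer τ P A A ≤ bondPairPer τ P J J := by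
      have hc2' : c ^ 2 * (c⁻¹ ^ 2 * bondPairPer τ P J J) = bondPairPer τ P J J := by
        rw [← mul_assoc, ← mul_pow, mul_inv_cancel₀ hc.ne', one_pow, one_mul]
      calc c ^ 2 * bondPairPer τ P A A ≤ c ^ 2 * (c⁻¹ ^ 2 * bondPairPer τ P J J) := mul_le_mul_of_nonneg_left hAA (by positivity)
        _ = bondPairPer τ P J J := hc2'
    calc ‖A y μ‖ ^ 2 * (κ * c ^ 2) = κ * c ^ 2 * ‖A y μ‖ ^ 2 := by ring
      _ ≤ bondPairPer τ P J J := h3.trans h4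
      _ ≤ (d : ℝ) * ((box (d := d) P).card : ℝ) * (Cτ * (t.η⁻¹ ^ 3 * nJ) ^ 2) := hJJ
      _ = (d : ℝ) * ((box (d := d) P).card : ℝ) * Cτ * (t.η⁻¹ ^ 3 * nJ) ^ 2 := by ring
  have hmax : K ≤ (max 1 K) ^ 2 := by
    have h1' : (1 : ℝ) ≤ max 1 K := le_max_left _ _
    calc K ≤ max 1 K := le_max_right _ _
      _ = max 1 K * 1 := (mul_one _).symm
      _ ≤ max 1 K * max 1 K := mul_le_mul_of_nonneg_left h1' (by positivity)
      _ = (max 1 K) ^ 2 := (sq _).symm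
  have h5 : ‖A y μ‖ ^ 2 ≤ (max 1 K * t.η⁻¹ ^ 3 * nJ) ^ 2 := by
    calc ‖A y μ‖ ^ 2 ≤ K * (t.η⁻¹ ^ 3 * nJ) ^ 2 := h2
      _ ≤ (max 1 K) ^ 2 * (t.η⁻¹ ^ 3 * nJ) ^ 2 := mul_le_mul_of_nonneg_right hmax (by positivity)
      _ = (max 1 K * t.η⁻¹ ^ 3 * nJ) ^ 2 := by ring
  have hnn : 0 ≤ max 1 K * t.η⁻¹ ^ 3 * nJ := by positivity
  exact (pow_le_pow_iff_left₀ (norm_nonneg _) hnn two_ne_zero).mp h5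

end Pointwise

/-! ## §5  The three global (3.47) entries: `GlobAtIPer` inhabited at the torus member; the `β = 0` Hölder binder -/

section Glob

variable [FiniteDimensional ℝ 𝔸] [Nontrivial 𝔸] (τ : 𝔸 →ₗ[ℂ] ℂ) (hτp : ∀ a : 𝔸, a ≠ 0 → 0 < (τ (star a * a)).re)
  (hτt : ∀ a b : 𝔸, τ (a * b) = τ (b * a)) (hτs : ∀ a : 𝔸, τ (star a) = starRingEnd ℂ (τ a)) {L P : ℕ} [NeZero P] [NeZero L]

include hτp hτt hτs in
/-- ★★★★ **THE GLOBAL (3.47) BLOCK OF THEOREM 3.3 AT `γ = −3` FOR THE GENUINE `G_𝔤^per`, PER MEMBER, ON THE TORUS** — `GlobAtIPer P L (opsAllZdPer τ L P torusLamb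
ops₀) aT B₀ M (torusIdx t) m` with member-dependent `aT, B₀ > 0`: for every `0 < α₀ ≤ aT`, every `P`-periodic unitary `U₀ ∈ 𝔄_m({ℤᵈ}, α₀)` and every periodic
Hermitian `J`, `|G_𝔤^per(U₀)J|₍₋₁₎, |∇_{U₀}G_𝔤^per(U₀)J|₍₋₂₎, |Δ_{U₀}G_𝔤^per(U₀)J|₍₋₃₎ ≤ B₀·|J|₍₋₃₎` (the pointwise bound of §4 with the weights `(Lʲη) ≤ (Lᵐη)` and
[B8] (1.1)'s `‖∇_U f‖ ≤ 2η⁻¹‖f‖_∞`, `‖Δ_U f‖ ≤ 4dη⁻²‖f‖_∞`; `0 < d`, `2 ≤ L`, `Lᵐ ∣ P`).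
[cite: Balaban1985BackgroundPropagators, (3.47) p.398, Thm 3.3 p.399; Balaban1984PropagatorsII, (2.22) p.226; Balaban1985RegularSpaces, (1.59) p.86, (1.7) p.77, p.77 («Ω_j = T_η»)] -/
theorem globAtIPer_opsAllZdPer_torusIdx (hd : 0 < d) (hL2 : 2 ≤ L) {Cτ : ℝ} (hCτ : ∀ x y : 𝔸, |(τ (star x * y)).re| ≤ Cτ * ‖x‖ * ‖y‖)
    (t : TorusMember) (ops₀ : ℝ → ZdIdx d L → ℕ → OpsZd d 𝔸) (M : ℝ) (m : ℕ) (hP : L ^ m ∣ P) :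
    ∃ aT : ℝ, 0 < aT ∧ ∃ B₀ : ℝ, 0 < B₀ ∧
      GlobAtIPer P L (opsAllZdPer τ L P (fun m => torusLamb m) ops₀) aT B₀ M (torusIdx (d := d) (le_trans (by norm_num) hL2) t) m := by
  have hL1 : 1 ≤ L := le_trans (by norm_num) hL2
  have hη : 0 < t.η := t.hη
  have hLr : (1 : ℝ) ≤ L := by exact_mod_cast hL1
  set i : ZdIdx d L := torusIdx (d := d) hL1 t with hi
  have hiΩ : ∀ j, i.Ω j = Set.univ := fun _ => rfl
  obtain ⟨α, hα, N, hN, h⟩ := exists_apply_bound_gopZdHPer_plaqNear_torusIdx τ hτp hτt hτs hd hL2 hCτ t ops₀ M m hP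
  obtain ⟨S, hS_def⟩ : ∃ S : ℝ, S = (L : ℝ) ^ m * t.η := ⟨_, rfl⟩
  have hS0 : 0 < S := by rw [hS_def]; positivity
  -- one constant for the three lines
  obtain ⟨B₀, hB₀_def⟩ : ∃ B₀ : ℝ, B₀ = S * N + S ^ 2 * (2 * t.η⁻¹ * N) + S ^ 3 * (4 * d * (t.η⁻¹ * (t.η⁻¹ * N))) + 1 := ⟨_, rfl⟩
  have hB₀1 : S * N ≤ B₀ := by
    rw [hB₀_def]
    have : 0 ≤ S ^ 2 * (2 * t.η⁻¹ * N) := by positivity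
    have : 0 ≤ S ^ 3 * (4 * d * (t.η⁻¹ * (t.η⁻¹ * N))) := by positivity
    linarith
  have hB₀2 : S ^ 2 * (2 * t.η⁻¹ * N) ≤ B₀ := by
    rw [hB₀_def]
    have : 0 ≤ S * N := by positivity
    have : 0 ≤ S ^ 3 * (4 * d * (t.η⁻¹ * (t.η⁻¹ * N))) := by positivity
    linarith
  have hB₀3 : S ^ 3 * (4 * d * (t.η⁻¹ * (t.η⁻¹ * N))) ≤ B₀ := by
    rw [hB₀_def]
    have : 0 ≤ S * N := by positivity
    have : 0 ≤ S ^ 2 * (2 * t.η⁻¹ * N) := by positivity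
    linarith
  have hB₀pos : 0 < B₀ := by
    rw [hB₀_def]
    have : 0 ≤ S * N := by positivity
    have : 0 ≤ S ^ 2 * (2 * t.η⁻¹ * N) := by positivity
    have : 0 ≤ S ^ 3 * (4 * d * (t.η⁻¹ * (t.η⁻¹ * N))) := by positivity
    linarith
  refine ⟨α, hα, B₀, hB₀pos, fun α₀ U₀ hU₀ hper hα₀ hα₀T hIn J hJ => ?_⟩
  have hnear : ∀ (x : Site d) (κ ν : Fin d), ‖plaqF U₀ κ ν x - 1‖ ≤ α :=
    fun x κ ν => (B9Thm311ClassCompactnessZdPer.plaq_near_of_inAk_univ (L := L) hα₀.le hIn κ ν x).trans hα₀T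
  obtain ⟨-, hpt⟩ := h U₀ hU₀ hper hnear
  have hU₀1 : ∀ x κ, U₀ x κ ∈ U1 𝔸 := fun x κ => unitaryUnits_le_U1 (hU₀ x κ)
  obtain ⟨nJ, hnJ_def⟩ : ∃ nJ : ℝ, nJ = bondNorm L m i.η (-(3 : ℝ)) i.Ω J := ⟨_, rfl⟩
  have hnJ0 : 0 ≤ nJ := by rw [hnJ_def]; exact B8ScaledSupNorm.msup_nonneg L m hη.le _ _ _
  obtain ⟨A, hA_def⟩ : ∃ A : Site d → Fin d → 𝔸,
      A = gopZdHPer t.η (opsLandauPer τ P (withDpZd (withQQP τ L (fun m => torusLamb (d := d) m) ops₀)) M i m) P U₀ J := ⟨_, rfl⟩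
  have hAb : ∀ (y : Site d) (μ : Fin d), ‖A y μ‖ ≤ N * nJ := fun y μ => by rw [hA_def, hnJ_def]; exact hpt J hJ y μ
  have hweight : ∀ (n j : ℕ), j ≤ m → weight L i.η (-(n : ℝ)) j ≤ S ^ n := by
    intro n j hj
    rw [B8ScaledSupNorm.weight_neg_natCast, hS_def]
    exact pow_le_pow_left₀ (by positivity) (mul_le_mul_of_nonneg_right (pow_le_pow_right₀ hLr hj) hη.le) n
  have hG : (opsAllZdPer τ L P (fun m => torusLamb (d := d) m) ops₀ M i m).Gop U₀ J = A := by rw [hA_def]; rfl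
  rw [hG, ← hnJ_def]
  refine ⟨?_, ?_, ?_⟩
  · -- |G J|₍₋₁₎ ≤ S·N·|J|
    have e1 : (-(1 : ℝ)) = -((1 : ℕ) : ℝ) := by norm_num
    refine (B8ScaledSupNorm.msup_le (by positivity) fun j hj b _ => ?_).trans (mul_le_mul_of_nonneg_right hB₀1 hnJ0)
    rw [e1]
    calc weight L i.η (-((1 : ℕ) : ℝ)) j * ‖A b.1 b.2‖ ≤ S ^ 1 * (N * nJ) := mul_le_mul (hweight 1 j hj) (hAb b.1 b.2) (norm_nonneg _) (by positivity)
      _ = S * N * nJ := by ring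
  · -- |∇ G J|₍₋₂₎ ≤ S²·2η⁻¹N·|J|
    have e2 : (-(2 : ℝ)) = -((2 : ℕ) : ℝ) := by norm_num
    refine (B8ScaledSupNorm.msup_le (by positivity) fun j hj q _ => ?_).trans (mul_le_mul_of_nonneg_right hB₀2 hnJ0)
    rw [e2]
    have hD : ‖covDerivFwd i.η U₀ q.1 (fun z => A z q.2.1) q.2.2‖ ≤ i.η⁻¹ * (N * nJ + N * nJ) :=
      (norm_covDerivFwd_le hη (hU₀1 _ _) _).trans (mul_le_mul_of_nonneg_left (add_le_add (hAb _ _) (hAb _ _)) (inv_nonneg.mpr hη.le))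
    calc weight L i.η (-((2 : ℕ) : ℝ)) j * ‖covDerivFwd i.η U₀ q.1 (fun z => A z q.2.1) q.2.2‖ ≤ S ^ 2 * (i.η⁻¹ * (N * nJ + N * nJ)) :=
          mul_le_mul (hweight 2 j hj) hD (norm_nonneg _) (by positivity)
      _ = S ^ 2 * (2 * t.η⁻¹ * N) * nJ := by rw [show i.η = t.η from rfl]; ring
  · -- |Δ G J|₍₋₃₎ ≤ S³·4dη⁻²N·|J|
    have e3 : (-(3 : ℝ)) = -((3 : ℕ) : ℝ) := by norm_num
    refine (B8ScaledSupNorm.msup_le (by positivity) fun j hj b _ => ?_).trans (mul_le_mul_of_nonneg_right hB₀3 hnJ0)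
    rw [e3]
    have hD : ‖covLap i.η U₀ (fun w => A w b.2) b.1‖ ≤ 4 * d * (i.η⁻¹ * (i.η⁻¹ * (N * nJ))) :=
      norm_covLap_le hη hU₀1 (fun w => hAb w b.2) b.1
    calc weight L i.η (-((3 : ℕ) : ℝ)) j * ‖covLap i.η U₀ (fun w => A w b.2) b.1‖ ≤ S ^ 3 * (4 * d * (i.η⁻¹ * (i.η⁻¹ * (N * nJ)))) :=
          mul_le_mul (hweight 3 j hj) hD (norm_nonneg _) (by positivity)
      _ = S ^ 3 * (4 * d * (t.η⁻¹ * (t.η⁻¹ * N))) * nJ := by rw [show i.η = t.η from rfl]; ring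

omit [Nontrivial 𝔸] [NeZero P] [NeZero L] in
/-- **THE RECORD'S `Gop` IS PERIODIC HERMITIAN AT EVERY BACKGROUND** (`G_𝔤^per(U₀)J ∈ E_𝔤^per(P)` by construction) — the input of lit-balaban t2s's `β = 0` Hölder file.
[cite: Balaban1985BackgroundPropagators, (3.27) p.395; Balaban1985RegularSpaces, p.77 («Ω_j = T_η»)] -/
theorem gop_isPeriodic_opsAllZdPer' (ΛbP : ℕ → ℕ → Set (Site d × Fin d)) (ops₀ : ℝ → ZdIdx d L → ℕ → OpsZd d 𝔸) (M : ℝ) (i : ZdIdx d L) (m : ℕ)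
    (U₀ : Site d → Fin d → 𝔸ˣ) (J : Site d → Fin d → 𝔸) : IsPeriodic P ((opsAllZdPer τ L P ΛbP ops₀ M i m).Gop U₀ J) :=
  ((mem_domSubHPer_iff P _).1 (gopZdHPer_mem_domSubHPer i.η (opsLandauPer τ P (withDpZd (withQQP τ L ΛbP ops₀)) M i m) P U₀ J)).1

include hτp hτt hτs in
/-- ★★★ **THE HÖLDER BINDER AT `β = 0` FOR THE GENUINE TORUS RECORD, PER MEMBER** (`2 ≤ d`, `2 ≤ L`, `Lᵐ ∣ P`, any `len`): `∃ aT B₀ > 0` with `GlobAtIPer … aT B₀` AND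
`HolderAtIPer … aT (2B₀) 0 len` at `torusIdx` — lit-balaban t2s's `holderAtIPer_zero_of_globAtIPer` on §5.
[cite: Balaban1985BackgroundPropagators, (3.45), (3.47) p.398, Thm 3.3 p.399; Balaban1985RegularSpaces, (1.59) p.86, p.77 («Ω_j = T_η»)] -/
theorem glob_holderAtIPer_zero_opsAllZdPer_torusIdx (hd2 : 2 ≤ d) (hL2 : 2 ≤ L) {Cτ : ℝ} (hCτ : ∀ x y : 𝔸, |(τ (star x * y)).re| ≤ Cτ * ‖x‖ * ‖y‖)
    (t : TorusMember) (ops₀ : ℝ → ZdIdx d L → ℕ → OpsZd d 𝔸) (M : ℝ) (m : ℕ) (hP : L ^ m ∣ P) (len : Site d → ℝ) :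
    ∃ aT : ℝ, 0 < aT ∧ ∃ B₀ : ℝ, 0 < B₀ ∧
      GlobAtIPer P L (opsAllZdPer τ L P (fun m => torusLamb m) ops₀) aT B₀ M (torusIdx (d := d) (le_trans (by norm_num) hL2) t) m ∧
      HolderAtIPer P L (opsAllZdPer τ L P (fun m => torusLamb m) ops₀) aT (2 * B₀) 0 len M (torusIdx (d := d) (le_trans (by norm_num) hL2) t) m := by
  have hL1 : 1 ≤ L := le_trans (by norm_num) hL2
  obtain ⟨aT, haT, B₀, hB₀, hglob⟩ := globAtIPer_opsAllZdPer_torusIdx τ hτp hτt hτs (lt_of_lt_of_le (by norm_num) hd2) hL2 hCτ t ops₀ M m hP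
  refine ⟨aT, haT, B₀, hB₀, hglob, ?_⟩
  exact B9B8KnitHolderZeroOfGlob.holderAtIPer_zero_of_globAtIPer hd2 hL1 (fun _ => rfl) hB₀.le
    (fun U₀ J _ _ => gop_isPeriodic_opsAllZdPer' τ (fun m => torusLamb (d := d) m) ops₀ M _ m U₀ J) len hglob

end Glob

/-! ## §6  The periodic socket of [B8] (1.59) for the genuine record at the torus member, no binder of Bałaban's left -/

section Socket

variable [FiniteDimensional ℝ 𝔸] [Nontrivial 𝔸] (τ : 𝔸 →ₗ[ℂ] ℂ) (hτp : ∀ a : 𝔸, a ≠ 0 → 0 < (τ (star a * a)).re)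
  (hτt : ∀ a b : 𝔸, τ (a * b) = τ (b * a)) (hτs : ∀ a : 𝔸, τ (star a) = starRingEnd ℂ (τ a)) {L P : ℕ} [NeZero P] [NeZero L]

omit [CStarAlgebra 𝔸] [FiniteDimensional ℝ 𝔸] [Nontrivial 𝔸] [NeZero P] [NeZero L] in
/-- **EDITION P₀'s CLASS LAW AT THE ALL-TORUS CLASS** (`Ω_j = ℤᵈ`, class bonds only at the top level `m`, collar parameter `s = 0`).
[cite: Balaban1985RegularSpaces, (1.31) p.82, (1.37) p.82, p.77 («Ω_j = T_η»)] -/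
theorem levelSepPP0_torusIdx' (hL1 : 1 ≤ L) (t : TorusMember) (m : ℕ) :
    B9Eq316AveragingTransposeZdLevelZero.LevelSepPP0 L m (torusIdx (d := d) hL1 t).Ω (torusIdx (d := d) hL1 t).Λb 0 := by
  intro j _ c hc y _
  have hjm : j = m := (mem_torusLamb_iff m j c).1 hc
  exact ⟨fun _ => Set.mem_univ _, fun i' hi' _ _ => by omega⟩

include hτp hτt hτs in
/-- ★★★★★ **THE PERIODIC SOCKET OF [B8] (1.59) FOR THE GENUINE RECORD AT THE TORUS MEMBER — NO BINDER OF BAŁABAN'S LEFT** (`β = 0`).  For `2 ≤ d`, `2 ≤ L`,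
`Lᵐ ∣ P`, a block parameter `M ≥ 1`, a faithful Hermitian tracial `τ` with `|Re τ(x*y)| ≤ C_τ‖x‖‖y‖` on a finite-dimensional non-trivial fibre, and any `len`:
`∃ aI aT B₀ > 0` with `SockB9P3Per P L B₀′ B₀β′ cP 0 len η m {ℤᵈ} torusLam torusLamb` for the genuine four-letter periodic record `opsAllZdPer τ L P torusLamb ops₀` at
`torusIdx t`, `B₀′ = max{1, 2B₀max{1,q}}`, `B₀β′ = 2·max{0, 2B₀}·max{1,q}`, `cP = min{1∕16, aI, aT, 1∕(2B₀·14(d−1)·M+1)}`, `q = qQ d L C_τ β_τ 0` — EVERY binder of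
`sockB9P3Per_opsAllZdPer_of_binders` discharged by name: `InvAtHIPer` (FILE 2, Thm 3.11 by compactness), `GlobAtIPer` (§5, Thm 3.3 (3.47)@−3 by compactness),
`HolderAtIPer` at `β = 0` (lit-balaban t2s), the structural binders (dag-n06-b g22).  The J-N06→N05 junction on the torus, per member; print's uniformity in the
volume (Thm 3.3 ∕ 3.11 proper) is what [B8]'s Theorem 4 needs beyond this.
[cite: Balaban1985RegularSpaces, (1.58)–(1.59) p.86, Prop. 3 p.87, (1.7) p.77, p.77 («Ω_j = T_η»); Balaban1985BackgroundPropagators, Thm 3.3 p.399, (3.47) p.398, (3.27) p.395, Thm 3.11 p.416, (3.16) p.393; Balaban1984PropagatorsII, (2.22) p.226] -/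
theorem sockB9P3Per_genuine_torusIdx (hd2 : 2 ≤ d) (hL2 : 2 ≤ L)
    {Cτ : ℝ} (hCτ : ∀ x y : 𝔸, |(τ (star x * y)).re| ≤ Cτ * ‖x‖ * ‖y‖)
    (t : TorusMember) (ops₀ : ℝ → ZdIdx d L → ℕ → OpsZd d 𝔸) {M : ℝ} (hM1 : 1 ≤ M) (m : ℕ) (hP : L ^ m ∣ P) (len : Site d → ℝ) :
    ∃ aI : ℝ, 0 < aI ∧ ∃ aT : ℝ, 0 < aT ∧ ∃ B₀ : ℝ, 0 < B₀ ∧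
      SockB9P3Per (𝔸 := 𝔸) P L (max 1 (2 * B₀ * max 1 (qQ d L Cτ (betaTau τ) 0))) (2 * max 0 (2 * B₀) * max 1 (qQ d L Cτ (betaTau τ) 0))
        (min (1 / 16) (min aI (min aT (1 / (2 * B₀ * (14 * ((d - 1 : ℕ) : ℝ)) * M + 1))))) 0 len
        (torusIdx (d := d) (le_trans (by norm_num) hL2) t).η m (torusIdx (d := d) (le_trans (by norm_num) hL2) t).Ω
        (torusIdx (d := d) (le_trans (by norm_num) hL2) t).Λs (torusIdx (d := d) (le_trans (by norm_num) hL2) t).Λb := by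
  have hL1 : 1 ≤ L := le_trans (by norm_num) hL2
  have hd : 0 < d := lt_of_lt_of_le (by norm_num) hd2
  obtain ⟨aI, haI, hinv⟩ := invAtHIPer_opsAllZdPer_torusIdx τ hτp hτt hτs hd hL2 t ops₀ M m hP
  obtain ⟨aT, haT, B₀, hB₀, hglob, hhol⟩ := glob_holderAtIPer_zero_opsAllZdPer_torusIdx τ hτp hτt hτs hd2 hL2 hCτ t ops₀ M m hP len
  refine ⟨aI, haI, aT, haT, B₀, hB₀, ?_⟩
  exact sockB9P3Per_opsAllZdPer_of_binders L τ P hd2 hL2 hτp hτt hτs hCτ ops₀ hM1 (torusIdx (d := d) hL1 t) rfl hP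
    (fun j _ κ => B9Thm311FlatPositivityZdPer.isPeriodic_mem_torusLamb (P / L ^ j) m j κ) (levelSepPP0_torusIdx' hL1 t m) hinv hglob hhol hB₀

end Socket

/-! ## §7  The Hölder binder for a general exponent `0 ≤ β` (integer-length admissible pairs) and the `β`-socket -/

section HolderBeta

variable [FiniteDimensional ℝ 𝔸] [Nontrivial 𝔸] (τ : 𝔸 →ₗ[ℂ] ℂ) (hτp : ∀ a : 𝔸, a ≠ 0 → 0 < (τ (star a * a)).re)
  (hτt : ∀ a b : 𝔸, τ (a * b) = τ (b * a)) (hτs : ∀ a : 𝔸, τ (star a) = starRingEnd ℂ (τ a)) {L P : ℕ} [NeZero P] [NeZero L]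

omit [FiniteDimensional ℝ 𝔸] [NeZero L] in
/-- ★★ **ON THE TORUS, THE HÖLDER BINDER (3.45) AT ANY EXPONENT `0 ≤ β` FOLLOWS FROM THE GRADIENT ENTRY OF (3.47)** — crude, per member: for a record whose Green's
function is periodic at periodic data, at a member with `Ω_j = ℤᵈ` (`2 ≤ d`, `1 ≤ L`) and a length with `len v ≥ 1` whenever `len v > 0` (the lattice lengths),
`GlobAtIPer P L ops aT B₀ M i m ⟹ HolderAtIPer P L ops aT (2B₀·(Lᵐ)^β) β len M i m`: the quotient `|R(U₀(Γ))F(x′) − F(x)|∕(η·len)^β ≤ (‖F x′‖ + ‖F x‖)·η^{−β}` and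
`(Lʲη)^{2+β} ≤ (Lʲη)²·(Lᵐη)^β`; lit-balaban t2s's `holderAtIPer_zero_of_globAtIPer` is the case `β = 0`.
[cite: Balaban1985BackgroundPropagators, (3.45), (3.47) p.398, (3.40) p.397, Thm 3.3 p.399; Balaban1985RegularSpaces, (1.59) p.86, p.77 («Ω_j = T_η»)] -/
theorem holderAtIPer_of_globAtIPer_of_len (hd2 : 2 ≤ d) (hL : 1 ≤ L)
    {ops : ℝ → ZdIdx d L → ℕ → OpsZd d 𝔸} {aT B₀ M : ℝ} {i : ZdIdx d L} {m : ℕ} (hΩ : ∀ j, i.Ω j = Set.univ) (hB₀ : 0 ≤ B₀)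
    (hGper : ∀ (U₀ : Site d → Fin d → 𝔸ˣ) (J : Site d → Fin d → 𝔸), IsPeriodic P U₀ → J ∈ domSubHPer (d := d) (𝔸 := 𝔸) P →
      IsPeriodic P ((ops M i m).Gop U₀ J))
    {β : ℝ} (hβ : 0 ≤ β) {len : Site d → ℝ} (hlen : ∀ v : Site d, 0 < len v → 1 ≤ len v) (h : GlobAtIPer P L ops aT B₀ M i m) :
    HolderAtIPer P L ops aT (2 * B₀ * (((L : ℝ) ^ m) ^ β)) β len M i m := by
  intro α₀ U₀ hU₀ hper hα hαT hIn J hJ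
  obtain ⟨-, h1, -⟩ := h α₀ U₀ hU₀ hper hα hαT hIn J hJ
  set G := (ops M i m).Gop U₀ J with hG
  set F : Fin d × Fin d × Site d → 𝔸 := fun t => covDerivFwd i.η U₀ t.1 (fun z => G z t.2.1) t.2.2 with hF
  set NJ := bondNorm L m i.η (-(3 : ℝ)) i.Ω J with hNJ
  have hη := i.hη
  have hNJ0 : 0 ≤ NJ := B8ScaledSupNorm.msup_nonneg L m hη.le _ _ _
  have hU1 : ∀ y κ, U₀ y κ ∈ U1 𝔸 := fun y κ => unitaryUnits_le_U1 (hU₀ y κ)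
  -- the gradient family is periodic, hence bounded, hence its weighted members are below its weighted supremum
  have hGp : IsPeriodic P G := hGper U₀ J hper hJ
  have hFper : ∀ ν κ : Fin d, IsPeriodic P fun x => F (ν, κ, x) := fun ν κ =>
    B9Eq327GreenZdHermPer.isPeriodic_covDerivFwd i.η hper ν (isPeriodic_apply_dir hGp κ)
  have hbd : ∀ t, ‖F t‖ ≤ ∑ ν : Fin d, ∑ κ : Fin d, ∑ ξ : Fin d → ZMod P, ‖F (ν, κ, tlift ξ)‖ := by
    rintro ⟨ν, κ, x⟩
    calc ‖F (ν, κ, x)‖ ≤ ∑ ξ : Fin d → ZMod P, ‖F (ν, κ, tlift ξ)‖ := B9B8KnitHolderZeroOfGlob.norm_le_sum_box_of_isPeriodic (hFper ν κ) x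
      _ ≤ ∑ κ' : Fin d, ∑ ξ : Fin d → ZMod P, ‖F (ν, κ', tlift ξ)‖ :=
          Finset.single_le_sum (f := fun κ' : Fin d => ∑ ξ : Fin d → ZMod P, ‖F (ν, κ', tlift ξ)‖)
            (fun _ _ => Finset.sum_nonneg fun _ _ => norm_nonneg _) (Finset.mem_univ κ)
      _ ≤ ∑ ν' : Fin d, ∑ κ' : Fin d, ∑ ξ : Fin d → ZMod P, ‖F (ν', κ', tlift ξ)‖ :=
          Finset.single_le_sum (f := fun ν' : Fin d => ∑ κ' : Fin d, ∑ ξ : Fin d → ZMod P, ‖F (ν', κ', tlift ξ)‖)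
            (fun _ _ => Finset.sum_nonneg fun _ _ => Finset.sum_nonneg fun _ _ => norm_nonneg _) (Finset.mem_univ ν)
  set c := ∑ ν : Fin d, ∑ κ : Fin d, ∑ ξ : Fin d → ZMod P, ‖F (ν, κ, tlift ξ)‖ with hc
  have hLr : (1 : ℝ) ≤ L := by exact_mod_cast hL
  have hBdd : Bdd L m i.η (-(2 : ℝ)) (fun j (t : Fin d × Fin d × Site d) => SideTouches (i.Ω j) t.2.2 t.2.1) F := by
    have e2 : (-(2 : ℝ)) = -((2 : ℕ) : ℝ) := by norm_num
    rw [e2]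
    refine B8ScaledSupNorm.bdd_of_forall (c := ((L : ℝ) ^ m * i.η) ^ 2 * c) fun j hj t _ => ?_
    rw [B8ScaledSupNorm.weight_neg_natCast]
    have hw : ((L : ℝ) ^ j * i.η) ^ 2 ≤ ((L : ℝ) ^ m * i.η) ^ 2 :=
      pow_le_pow_left₀ (by positivity) (mul_le_mul_of_nonneg_right (pow_le_pow_right₀ hLr hj) hη.le) 2
    exact mul_le_mul hw (hbd t) (norm_nonneg _) (by positivity)
  have hmem : ∀ (j : ℕ) (x : Site d) (κ : Fin d), SideTouches (i.Ω j) x κ := fun j x κ => by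
    rw [hΩ j]; exact B8Thm2TorusSupplier.sideTouches_univ hd2 x κ
  have hpt : ∀ j, j ≤ m → ∀ (ν κ : Fin d) (x : Site d), weight L i.η (-(2 : ℝ)) j * ‖F (ν, κ, x)‖ ≤ B₀ * NJ := fun j hj ν κ x =>
    (B8ScaledSupNorm.weight_mul_norm_le_msup hBdd hj (i := (ν, κ, x)) (hmem j x κ)).trans h1
  -- the Hölder supremum at exponent `β`
  have hLm0 : (0 : ℝ) ≤ (L : ℝ) ^ m := by positivity
  have hCβ0 : 0 ≤ 2 * B₀ * (((L : ℝ) ^ m) ^ β) := by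
    have : 0 ≤ ((L : ℝ) ^ m) ^ β := Real.rpow_nonneg hLm0 β
    positivity
  refine B8ScaledSupNorm.msup_le (by positivity) fun j hj q hq => ?_
  obtain ⟨ν, κ, x, x'⟩ := q
  have hq0 : 0 ≤ hquot i.η β len U₀ (covDerivFwd i.η U₀ ν fun z => G z κ) (x, x') := hquot_nonneg hη.le β U₀ _ hq.1
  rw [Real.norm_of_nonneg hq0]
  -- the weight: `(Lʲη)^{2+β} = (Lʲη)²·(Lʲη)^β ≤ (Lʲη)²·(Lᵐη)^β`
  have hs0 : 0 < (L : ℝ) ^ j * i.η := by positivity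
  have hsm : (L : ℝ) ^ j * i.η ≤ (L : ℝ) ^ m * i.η := mul_le_mul_of_nonneg_right (pow_le_pow_right₀ hLr hj) hη.le
  have hwsplit : weight L i.η (-(2 + β)) j = weight L i.η (-(2 : ℝ)) j * ((L : ℝ) ^ j * i.η) ^ β := by
    simp only [weight, neg_neg]
    rw [Real.rpow_add hs0, Real.rpow_two]
  have hwβ : ((L : ℝ) ^ j * i.η) ^ β ≤ ((L : ℝ) ^ m * i.η) ^ β := Real.rpow_le_rpow hs0.le hsm hβ
  -- the quotient: `≤ (‖F x′‖ + ‖F x‖)·η^{−β}`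
  have hηβ : 0 < i.η ^ β := Real.rpow_pos_of_pos hη β
  have hden : i.η ^ β ≤ (i.η * len ((x, x').2 - (x, x').1)) ^ β := by
    apply Real.rpow_le_rpow hη.le _ hβ
    have := hlen _ hq.1.1
    nlinarith
  have hnum : ‖trans U₀ (x, x').1 (x, x').2 ((covDerivFwd i.η U₀ ν fun z => G z κ) (x, x').2) - (covDerivFwd i.η U₀ ν fun z => G z κ) (x, x').1‖ ≤
      ‖F (ν, κ, x')‖ + ‖F (ν, κ, x)‖ := by
    calc _ ≤ ‖trans U₀ (x, x').1 (x, x').2 ((covDerivFwd i.η U₀ ν fun z => G z κ) (x, x').2)‖ + ‖(covDerivFwd i.η U₀ ν fun z => G z κ) (x, x').1‖ :=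
          norm_sub_le _ _
      _ = ‖F (ν, κ, x')‖ + ‖F (ν, κ, x)‖ := by rw [B9Eq340HolderZd.norm_trans hU1]
  have hquo : hquot i.η β len U₀ (covDerivFwd i.η U₀ ν fun z => G z κ) (x, x') ≤ (‖F (ν, κ, x')‖ + ‖F (ν, κ, x)‖) * (i.η ^ β)⁻¹ := by
    rw [B9Eq340HolderZd.hquot_def, div_eq_mul_inv]
    exact mul_le_mul hnum (inv_anti₀ hηβ hden) (inv_nonneg.2 (Real.rpow_nonneg (mul_nonneg hη.le hq.1.1.le) β)) (by positivity)
  -- `(Lᵐη)^β · η^{−β} = (Lᵐ)^β`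
  have hratio : ((L : ℝ) ^ m * i.η) ^ β * (i.η ^ β)⁻¹ = ((L : ℝ) ^ m) ^ β := by
    rw [Real.mul_rpow hLm0 hη.le, mul_assoc, mul_inv_cancel₀ hηβ.ne', mul_one]
  have hw2 : 0 ≤ weight L i.η (-(2 : ℝ)) j := B8ScaledSupNorm.weight_nonneg L hη.le _ j
  calc weight L i.η (-(2 + β)) j * hquot i.η β len U₀ (covDerivFwd i.η U₀ ν fun z => G z κ) (x, x')
      ≤ (weight L i.η (-(2 : ℝ)) j * ((L : ℝ) ^ m * i.η) ^ β) * ((‖F (ν, κ, x')‖ + ‖F (ν, κ, x)‖) * (i.η ^ β)⁻¹) := by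
        rw [hwsplit]
        exact mul_le_mul (mul_le_mul_of_nonneg_left hwβ hw2) hquo hq0 (mul_nonneg hw2 (Real.rpow_nonneg (hs0.le.trans hsm) β))
    _ = (((L : ℝ) ^ m * i.η) ^ β * (i.η ^ β)⁻¹) *
          (weight L i.η (-(2 : ℝ)) j * ‖F (ν, κ, x')‖ + weight L i.η (-(2 : ℝ)) j * ‖F (ν, κ, x)‖) := by ring
    _ ≤ ((L : ℝ) ^ m) ^ β * (B₀ * NJ + B₀ * NJ) := by
        rw [hratio]
        exact mul_le_mul_of_nonneg_left (add_le_add (hpt j hj ν κ x') (hpt j hj ν κ x)) (Real.rpow_nonneg hLm0 β)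
    _ = 2 * B₀ * (((L : ℝ) ^ m) ^ β) * NJ := by ring

include hτp hτt hτs in
/-- ★★★★★ **THE PERIODIC SOCKET OF [B8] (1.59) FOR THE GENUINE RECORD AT THE TORUS MEMBER AT ANY HÖLDER EXPONENT `0 ≤ β`** (integer-length admissible pairs:
`len v ≥ 1` whenever `len v > 0`) — as `sockB9P3Per_genuine_torusIdx`, with the Hölder binder of §7 (`C_β = 2B₀(Lᵐ)^β`):
`∃ aI aT B₀ > 0, SockB9P3Per P L (max 1 (2B₀·max 1 q)) (2·max 0 (2B₀(Lᵐ)^β)·max 1 q) (min (1∕16) (min aI (min aT (1∕(2B₀·14(d−1)·M+1))))) β len η m {ℤᵈ} torusLam torusLamb`,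
`q = qQ d L C_τ β_τ 0`.  NO binder of Bałaban's left; per member (compactness constants).
[cite: Balaban1985RegularSpaces, (1.58)–(1.59) p.86, Prop. 3 p.87, p.77 («Ω_j = T_η»); Balaban1985BackgroundPropagators, Thm 3.3 p.399, (3.45), (3.47) p.398, (3.27) p.395, Thm 3.11 p.416] -/
theorem sockB9P3Per_genuine_torusIdx_beta (hd2 : 2 ≤ d) (hL2 : 2 ≤ L)
    {Cτ : ℝ} (hCτ : ∀ x y : 𝔸, |(τ (star x * y)).re| ≤ Cτ * ‖x‖ * ‖y‖)
    (t : TorusMember) (ops₀ : ℝ → ZdIdx d L → ℕ → OpsZd d 𝔸) {M : ℝ} (hM1 : 1 ≤ M) (m : ℕ) (hP : L ^ m ∣ P)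
    {β : ℝ} (hβ : 0 ≤ β) {len : Site d → ℝ} (hlen : ∀ v : Site d, 0 < len v → 1 ≤ len v) :
    ∃ aI : ℝ, 0 < aI ∧ ∃ aT : ℝ, 0 < aT ∧ ∃ B₀ : ℝ, 0 < B₀ ∧
      SockB9P3Per (𝔸 := 𝔸) P L (max 1 (2 * B₀ * max 1 (qQ d L Cτ (betaTau τ) 0)))
        (2 * max 0 (2 * B₀ * (((L : ℝ) ^ m) ^ β)) * max 1 (qQ d L Cτ (betaTau τ) 0))
        (min (1 / 16) (min aI (min aT (1 / (2 * B₀ * (14 * ((d - 1 : ℕ) : ℝ)) * M + 1))))) β len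
        (torusIdx (d := d) (le_trans (by norm_num) hL2) t).η m (torusIdx (d := d) (le_trans (by norm_num) hL2) t).Ω
        (torusIdx (d := d) (le_trans (by norm_num) hL2) t).Λs (torusIdx (d := d) (le_trans (by norm_num) hL2) t).Λb := by
  have hL1 : 1 ≤ L := le_trans (by norm_num) hL2
  have hd : 0 < d := lt_of_lt_of_le (by norm_num) hd2
  obtain ⟨aI, haI, hinv⟩ := invAtHIPer_opsAllZdPer_torusIdx τ hτp hτt hτs hd hL2 t ops₀ M m hP
  obtain ⟨aT, haT, B₀, hB₀, hglob⟩ := globAtIPer_opsAllZdPer_torusIdx τ hτp hτt hτs hd hL2 hCτ t ops₀ M m hP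
  have hhol := holderAtIPer_of_globAtIPer_of_len (P := P) hd2 hL1 (i := torusIdx (d := d) hL1 t) (fun _ => rfl) hB₀.le
    (fun U₀ J _ _ => gop_isPeriodic_opsAllZdPer' τ (fun m => torusLamb (d := d) m) ops₀ M _ m U₀ J) hβ hlen hglob
  refine ⟨aI, haI, aT, haT, B₀, hB₀, ?_⟩
  exact sockB9P3Per_opsAllZdPer_of_binders L τ P hd2 hL2 hτp hτt hτs hCτ ops₀ hM1 (torusIdx (d := d) hL1 t) rfl hP
    (fun j _ κ => B9Thm311FlatPositivityZdPer.isPeriodic_mem_torusLamb (P / L ^ j) m j κ) (levelSepPP0_torusIdx' hL1 t m) hinv hglob hhol hB₀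

end HolderBeta

end Literature.MathematicalPhysics.QuantumFieldTheory.Balaban1983to89.B9Thm33GlobalBlockWitnessZdPer

end
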